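import Literature.AlgebraicGeometry.HodgeTheory.FermatHodgeCharacterGlobal
import Literature.AlgebraicGeometry.HodgeTheory.FermatHodgeCharacterCriterion
import HarnessLib

/-!
# Aoki's group `U(f)`: local structure of units annihilated by all odd primitive characters (Aoki 1983, Prop. 6.1)

Support file VI (everything PROVED; no named facts, no definitions) for the structure theorem of
the Hodge characters of the Fermat surface (`AokiShioda1983_thmB2m_standard`). Aoki's group is
`U(f) = {w ∈ (ℤ/f)ˣ : χ(w) = 1 for all χ ∈ PC⁻(f)}` ([Aoki1983, §6]); equivalently `(1) - (w)`
is a length-`2` element of `A(f)`, so the rigidity lemmas (`FermatHodgeCharacterRigidity`) apply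
to the function `T = δ₁ - δ_w`. This file proves the LOCAL consequences (Step A of Prop. 6.1):
for `f = q n` with `q, n` coprime,

* `unitsMap_eq_pm_one_of_ker` — if `-1 ∉ U = ker((ℤ/q)ˣ → (ℤ/d)ˣ)`, `#U > 2` and every
  character mod `q` not factoring through `d` is primitive (`q = p^e`, `e ≥ 2`, `p` odd,
  `d = p^(e-1)`), then `w ≡ ±1 (mod q)`;
* `unitsMap_eq_pm_one_of_prime` — the same for `q` prime `≥ 5` when `PC⁺(n) ≠ ∅`
  (weight lemma), and `unitsMap_eq_pm_one_of_prime_seven` for `q` prime `≥ 7` and any `n`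
  (the levels `3p`, `4p`; pure counting `exists_free_pair_of_two_mul_card_lt`);
* `exists_ker_unitsMap_eq_pm_of_class` — in general `w ≡ ±u (mod q)` for some `u ∈ U`
  (`q = 2^e`, `e ≥ 3`: `w ≡ ±1, ±(1 + 2^(e-1))`, [Aoki1983, Cor. 3.4 / (8.1)]);

and then the GLOBAL statement (Step B), `coe_eq_of_forall_odd_isPrimitive`:
**[Aoki1983, Prop. 6.1]** for `f` odd or `4 ∣ f`, `f ∉ {15, 20}`:
`U(f) ⊆ {1, u, v, uv}` with `u = f/2 - 1` (present iff `4 ∣ f`) and `v = 2(f/3)² - 1`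
(`≡ 1 (mod 3)`, `≡ -1 (mod f/3)`; present iff `3 ∥ f`), by strong induction on `f`
(`step_odd`, the `2`-primary levels `coe_eq_two_pow_one/three`, and `f ∈ {1, 3, 4, 12}`).
The values `χ(u) = χ(v) = -χ(-1)` for every primitive `χ` (`apply_half_sub_one`,
`apply_two_mul_third_sq_sub_one`) give the converse inclusion.

Remarks on the source: Aoki's `v_δ = δ m'' + 1` is a misprint for the element `≡ 1 (mod 3)`,
`≡ -1 (mod f/3)`; and the levels `f = 15, 20` (where `U(15) ∋ 4`, `U(20) ∋ 3`) are genuine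
exceptions to Prop. 6.1 as printed (they never occur as conductors in the application, where
`f > 68`).

## References

* [Aoki1983] N. Aoki, On some arithmetic problems related to the Hodge cycles on the Fermat
  varieties, Math. Ann. 266 (1983) 23–54, §6 Prop. 6.1, Cor. 3.4 (text read).
-/

noncomputable section

open Finset

namespace Literature.AlgebraicGeometry.HodgeTheory

namespace FermatCharacter

section Local

variable {q n : ℕ} [NeZero q] [NeZero n]

/-- The test function `T = δ₁ - δ_w` of `w ∈ U(qn)` is annihilated by every odd primitive
character. [cite: Aoki1983, §6 (definition of U(m))] -/
theorem sum_delta_sub_delta_mul_char {N : ℕ} [NeZero N] {w : (ZMod N)ˣ} (hw1 : w ≠ 1)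
    (χ : DirichletCharacter ℂ N) (hχw : χ w = 1) :
    ∑ x : ZMod N, (if x = 1 then (1 : ℂ) else if x = (w : ZMod N) then -1 else 0) * χ x = 0 := by
  classical
  have hw1' : (w : ZMod N) ≠ 1 := fun h ↦ hw1 (Units.ext h)
  have hpt : ∀ x : ZMod N, (if x = 1 then (1 : ℂ) else if x = (w : ZMod N) then -1 else 0) * χ x =
      (if x = 1 then χ 1 else 0) + (if x = (w : ZMod N) then -χ w else 0) := by
    intro x
    by_cases hx1 : x = 1
    · subst hx1
      rw [if_pos rfl, if_pos rfl, if_neg (Ne.symm hw1'), one_mul, add_zero]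
    · rw [if_neg hx1, if_neg hx1, zero_add]
      by_cases hxw : x = (w : ZMod N)
      · subst hxw; rw [if_pos rfl, if_pos rfl]; ring
      · rw [if_neg hxw, if_neg hxw, zero_mul]
  rw [Finset.sum_congr rfl fun x _ ↦ hpt x, Finset.sum_add_distrib, Finset.sum_ite_eq',
    Finset.sum_ite_eq']
  simp only [Finset.mem_univ, if_true, map_one, hχw]
  ring

/-- If `w ≢ ±1 (mod q)`, the restriction of `δ₁ - δ_w` to `{x ≡ ±1 (mod q)}` is `δ₁`, whose
character sums are `1`. [folklore] -/
theorem sum_restrict_pair_delta {w : (ZMod (q * n))ˣ}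
    (hw : ZMod.castHom (dvd_mul_right q n) (ZMod q) (w : ZMod (q * n)) ≠ 1 ∧
      ZMod.castHom (dvd_mul_right q n) (ZMod q) (w : ZMod (q * n)) ≠ -1)
    (χ : DirichletCharacter ℂ (q * n)) :
    ∑ x : ZMod (q * n), (if ZMod.castHom (dvd_mul_right q n) (ZMod q) x = ((1 : (ZMod q)ˣ) : ZMod q) ∨
        ZMod.castHom (dvd_mul_right q n) (ZMod q) x = -((1 : (ZMod q)ˣ) : ZMod q) then
        (if x = 1 then (1 : ℂ) else if x = (w : ZMod (q * n)) then -1 else 0) else 0) * χ x = 1 := by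
  classical
  have hpt : ∀ x : ZMod (q * n), (if ZMod.castHom (dvd_mul_right q n) (ZMod q) x = ((1 : (ZMod q)ˣ) : ZMod q) ∨
        ZMod.castHom (dvd_mul_right q n) (ZMod q) x = -((1 : (ZMod q)ˣ) : ZMod q) then
        (if x = 1 then (1 : ℂ) else if x = (w : ZMod (q * n)) then -1 else 0) else 0) * χ x =
      if x = 1 then 1 else 0 := by
    intro x
    by_cases hx1 : x = 1
    · subst hx1
      rw [if_pos (Or.inl (by rw [map_one, Units.val_one])), if_pos rfl, if_pos rfl, map_one, mul_one]
    · by_cases hP : ZMod.castHom (dvd_mul_right q n) (ZMod q) x = ((1 : (ZMod q)ˣ) : ZMod q) ∨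
          ZMod.castHom (dvd_mul_right q n) (ZMod q) x = -((1 : (ZMod q)ˣ) : ZMod q)
      · rw [if_pos hP, if_neg hx1, if_neg hx1]
        by_cases hxw : x = (w : ZMod (q * n))
        · exfalso
          subst hxw
          rw [Units.val_one] at hP
          exact (not_or.mpr hw) hP
        · rw [if_neg hxw, zero_mul]
      · rw [if_neg hP, zero_mul, if_neg hx1]
  rw [Finset.sum_congr rfl fun x _ ↦ hpt x, Finset.sum_ite_eq']
  simp

omit [NeZero q] [NeZero n] in
/-- Conversion between the `unitsMap` and `castHom` forms of `w ≡ ±1 (mod q)`. [folklore] -/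
theorem unitsMap_eq_pm_one_iff (w : (ZMod (q * n))ˣ) :
    (ZMod.unitsMap (dvd_mul_right q n) w = 1 ∨ ZMod.unitsMap (dvd_mul_right q n) w = -1) ↔
    (ZMod.castHom (dvd_mul_right q n) (ZMod q) (w : ZMod (q * n)) = 1 ∨
      ZMod.castHom (dvd_mul_right q n) (ZMod q) (w : ZMod (q * n)) = -1) := by
  rw [Units.ext_iff, Units.ext_iff, coe_unitsMap, Units.val_one, Units.val_neg, Units.val_one]

/-- **Local structure at an odd prime power `q = p^e`, `e ≥ 2`** ([Aoki1983, Prop. 6.1 /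
Cor. 3.4]): if `w ∈ U(qn)` then `w ≡ ±1 (mod q)`. Hypotheses in the abstract form used by the
rigidity lemmas: `-1 ∉ U = ker((ℤ/q)ˣ → (ℤ/d)ˣ)`, `#U > 2`, and characters mod `q` not
factoring through `d` are primitive. [cite: Aoki1983, Prop. 6.1] -/
theorem unitsMap_eq_pm_one_of_ker (h : q.Coprime n) (hq2 : 2 < q) {d : ℕ} (hd : d ∣ q)
    (hprim : ∀ χ : DirichletCharacter ℂ q, ¬ χ.FactorsThrough d → χ.IsPrimitive)
    (hm1 : ZMod.unitsMap hd (-1) ≠ 1)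
    (hU : 2 < #(univ.filter fun u : (ZMod q)ˣ ↦ ZMod.unitsMap hd u = 1))
    (hPC : ∃ χ : DirichletCharacter ℂ (q * n), χ.Odd ∧ χ.IsPrimitive)
    (w : (ZMod (q * n))ˣ)
    (hw : ∀ χ : DirichletCharacter ℂ (q * n), χ.Odd → χ.IsPrimitive → χ w = 1) :
    ZMod.unitsMap (dvd_mul_right q n) w = 1 ∨ ZMod.unitsMap (dvd_mul_right q n) w = -1 := by
  classical
  haveI : NeZero (q * n) := ⟨mul_ne_zero (NeZero.ne q) (NeZero.ne n)⟩
  by_cases hw1 : w = 1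
  · left; rw [hw1, map_one]
  rw [unitsMap_eq_pm_one_iff]
  by_contra hcon
  rw [not_or] at hcon
  set T : ZMod (q * n) → ℂ := fun x ↦ if x = 1 then (1 : ℂ) else if x = (w : ZMod (q * n)) then -1 else 0
    with hT
  have hTann : ∀ χ : DirichletCharacter ℂ (q * n), χ.Odd → χ.IsPrimitive →
      ∑ x : ZMod (q * n), T x * χ x = 0 :=
    fun χ ho hp ↦ sum_delta_sub_delta_mul_char hw1 χ (hw χ ho hp)
  -- a free element of `U`
  set S : Finset (ZMod (q * n)) := {1, (w : ZMod (q * n))} with hS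
  have hcard : #S < #(univ.filter fun u : (ZMod q)ˣ ↦ ZMod.unitsMap hd u = 1) :=
    lt_of_le_of_lt (Finset.card_le_two) hU
  obtain ⟨u, hu, hfreeS⟩ := exists_free_of_card_lt (n := n) hd hm1 S 1 hcard
  have hfree : ∀ x : ZMod (q * n), T x ≠ 0 →
      ZMod.castHom (dvd_mul_right q n) (ZMod q) x ≠ (1 : (ZMod q)ˣ) * u ∧
        ZMod.castHom (dvd_mul_right q n) (ZMod q) x ≠ -((1 : (ZMod q)ˣ) * u) := by
    intro x hx
    apply hfreeS
    simp only [hT] at hx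
    rw [hS, Finset.mem_insert, Finset.mem_singleton]
    by_contra hmem
    rw [not_or] at hmem
    rw [if_neg hmem.1, if_neg hmem.2] at hx
    exact hx rfl
  obtain ⟨χ₀, hodd, hprim₀⟩ := hPC
  have key := annihilated_restrict_pair h hq2 hd hprim T hTann 1 u hu hfree χ₀ hodd hprim₀
  rw [sum_restrict_pair_delta hcon χ₀] at key
  exact one_ne_zero key

omit [NeZero n] in
/-- **Free pairs by pure counting**: if `2·#S < φ(q)` then some unit `a₁` mod `q` has no element
of `S` over `±a₁`. [folklore] -/
theorem exists_free_pair_of_two_mul_card_lt (S : Finset (ZMod (q * n)))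
    (hcard : 2 * #S < #(univ.filter fun a : ZMod q ↦ IsUnit a)) :
    ∃ a₁ : (ZMod q)ˣ, ∀ x ∈ S, ZMod.castHom (dvd_mul_right q n) (ZMod q) x ≠ a₁ ∧
      ZMod.castHom (dvd_mul_right q n) (ZMod q) x ≠ -a₁ := by
  classical
  set A : Finset (ZMod q) := univ.filter fun a : ZMod q ↦ IsUnit a with hA
  set fib : ZMod (q * n) → Finset (ZMod q) := fun x ↦
    {ZMod.castHom (dvd_mul_right q n) (ZMod q) x, -ZMod.castHom (dvd_mul_right q n) (ZMod q) x}
    with hfib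
  set Bad : Finset (ZMod q) := S.biUnion fib with hBad
  have hBadcard : #Bad ≤ 2 * #S := by
    calc #Bad ≤ ∑ x ∈ S, #(fib x) := Finset.card_biUnion_le
      _ ≤ ∑ x ∈ S, 2 := Finset.sum_le_sum fun x _ ↦ Finset.card_le_two
      _ = 2 * #S := by rw [Finset.sum_const, smul_eq_mul, mul_comm]
  obtain ⟨a₁, haA, haB⟩ := Finset.exists_mem_notMem_of_card_lt_card (lt_of_le_of_lt hBadcard hcard)
  have ha₁ : IsUnit a₁ := (mem_filter.mp haA).2
  refine ⟨ha₁.unit, fun x hx ↦ ?_⟩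
  have hxa : a₁ ∉ fib x := fun hmem ↦ haB (Finset.mem_biUnion.mpr ⟨x, hx, hmem⟩)
  simp only [hfib, Finset.mem_insert, Finset.mem_singleton, not_or] at hxa
  rw [IsUnit.unit_spec]
  exact ⟨Ne.symm hxa.1, fun h2 ↦ hxa.2 (by rw [h2, neg_neg])⟩

/-- **Local structure at a prime `q ≥ 7`, any complementary level `n`** (covers `f = 3p, 4p`,
[Aoki1983, Prop. 6.5]): if `w ∈ U(qn)` then `w ≡ ±1 (mod q)` (a free pair exists by counting:
`2·2 < q - 1`). [cite: Aoki1983, Prop. 6.1 and Prop. 6.5] -/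
theorem unitsMap_eq_pm_one_of_prime_seven (h : q.Coprime n) (hq : q.Prime) (hq7 : 7 ≤ q)
    (hPC : ∃ χ : DirichletCharacter ℂ (q * n), χ.Odd ∧ χ.IsPrimitive)
    (w : (ZMod (q * n))ˣ)
    (hw : ∀ χ : DirichletCharacter ℂ (q * n), χ.Odd → χ.IsPrimitive → χ w = 1) :
    ZMod.unitsMap (dvd_mul_right q n) w = 1 ∨ ZMod.unitsMap (dvd_mul_right q n) w = -1 := by
  classical
  haveI : NeZero (q * n) := ⟨mul_ne_zero (NeZero.ne q) (NeZero.ne n)⟩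
  haveI : Fact q.Prime := ⟨hq⟩
  by_cases hw1 : w = 1
  · left; rw [hw1, map_one]
  rw [unitsMap_eq_pm_one_iff]
  by_contra hcon
  rw [not_or] at hcon
  set T : ZMod (q * n) → ℂ := fun x ↦ if x = 1 then (1 : ℂ) else if x = (w : ZMod (q * n)) then -1 else 0
    with hT
  have hTann : ∀ χ : DirichletCharacter ℂ (q * n), χ.Odd → χ.IsPrimitive →
      ∑ x : ZMod (q * n), T x * χ x = 0 :=
    fun χ ho hp ↦ sum_delta_sub_delta_mul_char hw1 χ (hw χ ho hp)
  set S : Finset (ZMod (q * n)) := {1, (w : ZMod (q * n))} with hS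
  have hunits : #(univ.filter fun a : ZMod q ↦ IsUnit a) = q - 1 := by
    rw [card_filter_isUnit, Nat.totient_prime hq]
  have hcard : 2 * #S < #(univ.filter fun a : ZMod q ↦ IsUnit a) := by
    rw [hunits]
    have hS2 : #S ≤ 2 := Finset.card_le_two
    omega
  obtain ⟨a₁, hfreeS⟩ := exists_free_pair_of_two_mul_card_lt (n := n) S hcard
  have hfree : ∀ x : ZMod (q * n), T x ≠ 0 →
      ZMod.castHom (dvd_mul_right q n) (ZMod q) x ≠ (1 : (ZMod q)ˣ) * a₁ ∧
        ZMod.castHom (dvd_mul_right q n) (ZMod q) x ≠ -((1 : (ZMod q)ˣ) * a₁) := by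
    intro x hx
    rw [Units.val_one, one_mul]
    apply hfreeS
    simp only [hT] at hx
    rw [hS, Finset.mem_insert, Finset.mem_singleton]
    by_contra hmem
    rw [not_or] at hmem
    rw [if_neg hmem.1, if_neg hmem.2] at hx
    exact hx rfl
  have hq2 : 2 < q := by omega
  obtain ⟨χ₀, hodd, hprim₀⟩ := hPC
  have key := annihilated_restrict_pair h hq2 (one_dvd q)
    (fun χ hχ ↦ isPrimitive_of_not_factorsThrough_one_prime hq χ hχ) T hTann 1 a₁
    (unitsMap_one_dvd a₁) hfree χ₀ hodd hprim₀
  rw [sum_restrict_pair_delta hcon χ₀] at key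
  exact one_ne_zero key

/-- **Local structure at a prime `q ≥ 5` when `PC⁺(n) ≠ ∅`** ([Aoki1983, Prop. 6.4 (i) /
Prop. 6.1]): if `w ∈ U(qn)` then `w ≡ ±1 (mod q)` (free pair from the weight lemma:
`#supp = 2 < q - 1`). [cite: Aoki1983, Prop. 6.1 and Prop. 6.4 (i)] -/
theorem unitsMap_eq_pm_one_of_prime (h : q.Coprime n) (hq : q.Prime) (hq5 : 5 ≤ q)
    (hPCn : ∃ χ₂ : DirichletCharacter ℂ n, χ₂.Even ∧ χ₂.IsPrimitive)
    (hPC : ∃ χ : DirichletCharacter ℂ (q * n), χ.Odd ∧ χ.IsPrimitive)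
    (w : (ZMod (q * n))ˣ)
    (hw : ∀ χ : DirichletCharacter ℂ (q * n), χ.Odd → χ.IsPrimitive → χ w = 1) :
    ZMod.unitsMap (dvd_mul_right q n) w = 1 ∨ ZMod.unitsMap (dvd_mul_right q n) w = -1 := by
  classical
  haveI : NeZero (q * n) := ⟨mul_ne_zero (NeZero.ne q) (NeZero.ne n)⟩
  haveI : Fact q.Prime := ⟨hq⟩
  by_cases hw1 : w = 1
  · left; rw [hw1, map_one]
  rw [unitsMap_eq_pm_one_iff]
  by_contra hcon
  rw [not_or] at hcon
  set T : ZMod (q * n) → ℂ := fun x ↦ if x = 1 then (1 : ℂ) else if x = (w : ZMod (q * n)) then -1 else 0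
    with hT
  have hTann : ∀ χ : DirichletCharacter ℂ (q * n), χ.Odd → χ.IsPrimitive →
      ∑ x : ZMod (q * n), T x * χ x = 0 :=
    fun χ ho hp ↦ sum_delta_sub_delta_mul_char hw1 χ (hw χ ho hp)
  have hTu : ∀ x : ZMod (q * n), ¬ IsUnit x → T x = 0 := by
    intro x hx
    have hx1 : x ≠ 1 := by rintro rfl; exact hx isUnit_one
    have hxw : x ≠ (w : ZMod (q * n)) := by rintro rfl; exact hx (Units.isUnit w)
    simp only [hT]
    rw [if_neg hx1, if_neg hxw]
  have hsupp : #(univ.filter fun x : ZMod (q * n) ↦ T x ≠ 0) ≤ 2 := by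
    have hsub : (univ.filter fun x : ZMod (q * n) ↦ T x ≠ 0) ⊆ {1, (w : ZMod (q * n))} := by
      intro x hx
      rw [Finset.mem_insert, Finset.mem_singleton]
      have hx' := (mem_filter.mp hx).2
      simp only [hT] at hx'
      by_contra hmem
      rw [not_or] at hmem
      rw [if_neg hmem.1, if_neg hmem.2] at hx'
      exact hx' rfl
    exact (Finset.card_le_card hsub).trans Finset.card_le_two
  have hcard : #(univ.filter fun x : ZMod (q * n) ↦ T x ≠ 0) < #(univ.filter fun a : ZMod q ↦ IsUnit a) := by
    rw [card_filter_isUnit, Nat.totient_prime hq]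
    omega
  have hq2 : 2 < q := by omega
  have hprim1 : ∀ χ : DirichletCharacter ℂ q, ¬ χ.FactorsThrough 1 → χ.IsPrimitive :=
    fun χ hχ ↦ isPrimitive_of_not_factorsThrough_one_prime hq χ hχ
  obtain ⟨a₁, hfreeT⟩ := exists_free_pair h hq2 hprim1 hPCn T hTu hTann hcard
  have hfree : ∀ x : ZMod (q * n), T x ≠ 0 →
      ZMod.castHom (dvd_mul_right q n) (ZMod q) x ≠ (1 : (ZMod q)ˣ) * a₁ ∧
        ZMod.castHom (dvd_mul_right q n) (ZMod q) x ≠ -((1 : (ZMod q)ˣ) * a₁) := by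
    intro x hx
    rw [Units.val_one, one_mul]
    exact hfreeT x hx
  obtain ⟨χ₀, hodd, hprim₀⟩ := hPC
  have key := annihilated_restrict_pair h hq2 (one_dvd q) hprim1 T hTann 1 a₁
    (unitsMap_one_dvd a₁) hfree χ₀ hodd hprim₀
  rw [sum_restrict_pair_delta hcon χ₀] at key
  exact one_ne_zero key

/-- **Local structure in general (coarse classes)** ([Aoki1983, Cor. 3.4]; used at `q = 2^e`,
`e ≥ 3`, where it gives `w ≡ ±1, ±(1 + 2^(e-1))`): if `w ∈ U(qn)` then `w ≡ ±u (mod q)` for some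
`u ∈ U = ker((ℤ/q)ˣ → (ℤ/d)ˣ)` (`d ∣ q`, `d ≠ q`, characters mod `q` not factoring through `d`
primitive). [cite: Aoki1983, Cor. 3.4] -/
theorem exists_ker_unitsMap_eq_pm_of_class (h : q.Coprime n) {d : ℕ} (hd : d ∣ q) (hdq : d ≠ q)
    (hprim : ∀ χ : DirichletCharacter ℂ q, ¬ χ.FactorsThrough d → χ.IsPrimitive)
    (hPC : ∃ χ : DirichletCharacter ℂ (q * n), χ.Odd ∧ χ.IsPrimitive)
    (w : (ZMod (q * n))ˣ)
    (hw : ∀ χ : DirichletCharacter ℂ (q * n), χ.Odd → χ.IsPrimitive → χ w = 1) :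
    ∃ u : (ZMod q)ˣ, ZMod.unitsMap hd u = 1 ∧
      (ZMod.unitsMap (dvd_mul_right q n) w = u ∨ ZMod.unitsMap (dvd_mul_right q n) w = -u) := by
  classical
  haveI : NeZero (q * n) := ⟨mul_ne_zero (NeZero.ne q) (NeZero.ne n)⟩
  by_cases hw1 : w = 1
  · exact ⟨1, map_one _, Or.inl (by rw [hw1, map_one])⟩
  by_contra hcon
  push Not at hcon
  -- the class predicate fails at `w`
  have hPw : ¬ ∃ u : (ZMod q)ˣ, ZMod.unitsMap hd u = 1 ∧
      (ZMod.castHom (dvd_mul_right q n) (ZMod q) (w : ZMod (q * n)) = (1 : (ZMod q)ˣ) * u ∨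
        ZMod.castHom (dvd_mul_right q n) (ZMod q) (w : ZMod (q * n)) = -((1 : (ZMod q)ˣ) * u)) := by
    rintro ⟨u, hu, hor⟩
    rw [Units.val_one, one_mul] at hor
    have h1 := hcon u hu
    rw [Ne, Ne, Units.ext_iff, Units.ext_iff, coe_unitsMap, Units.val_neg] at h1
    exact hor.elim h1.1 h1.2
  -- but it holds at `1`
  have hP1 : ∃ u : (ZMod q)ˣ, ZMod.unitsMap hd u = 1 ∧
      (ZMod.castHom (dvd_mul_right q n) (ZMod q) (1 : ZMod (q * n)) = (1 : (ZMod q)ˣ) * u ∨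
        ZMod.castHom (dvd_mul_right q n) (ZMod q) (1 : ZMod (q * n)) = -((1 : (ZMod q)ˣ) * u)) :=
    ⟨1, map_one _, Or.inl (by rw [map_one, Units.val_one, one_mul])⟩
  set T : ZMod (q * n) → ℂ := fun x ↦ if x = 1 then (1 : ℂ) else if x = (w : ZMod (q * n)) then -1 else 0
    with hT
  have hTann : ∀ χ : DirichletCharacter ℂ (q * n), χ.Odd → χ.IsPrimitive →
      ∑ x : ZMod (q * n), T x * χ x = 0 :=
    fun χ ho hp ↦ sum_delta_sub_delta_mul_char hw1 χ (hw χ ho hp)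
  obtain ⟨χ₀, hodd, hprim₀⟩ := hPC
  have key := annihilated_restrict_class h hd hdq hprim T hTann 1 χ₀ hodd hprim₀
  -- the restricted function is `δ₁`
  have hw1' : (w : ZMod (q * n)) ≠ 1 := fun h1 ↦ hw1 (Units.ext h1)
  have hpt : ∀ x : ZMod (q * n), (if ∃ u : (ZMod q)ˣ, ZMod.unitsMap hd u = 1 ∧
      (ZMod.castHom (dvd_mul_right q n) (ZMod q) x = (1 : (ZMod q)ˣ) * u ∨
        ZMod.castHom (dvd_mul_right q n) (ZMod q) x = -((1 : (ZMod q)ˣ) * u)) then T x else 0) * χ₀ x =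
      if x = 1 then 1 else 0 := by
    intro x
    by_cases hx1 : x = 1
    · subst hx1
      rw [if_pos hP1, if_pos rfl, map_one, mul_one]
      simp only [hT, if_true]
    · rw [if_neg hx1]
      by_cases hxw : x = (w : ZMod (q * n))
      · subst hxw
        rw [if_neg hPw, zero_mul]
      · have hTx : T x = 0 := by
          simp only [hT]
          rw [if_neg hx1, if_neg hxw]
        by_cases hP : ∃ u : (ZMod q)ˣ, ZMod.unitsMap hd u = 1 ∧
            (ZMod.castHom (dvd_mul_right q n) (ZMod q) x = (1 : (ZMod q)ˣ) * u ∨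
              ZMod.castHom (dvd_mul_right q n) (ZMod q) x = -((1 : (ZMod q)ˣ) * u))
        · rw [if_pos hP, hTx, zero_mul]
        · rw [if_neg hP, zero_mul]
  rw [Finset.sum_congr rfl fun x _ ↦ hpt x, Finset.sum_ite_eq'] at key
  simp at key

end Local

/-! ### The elements `u = f/2 - 1` and `v` of Aoki's Prop. 6.1: values of primitive characters -/

section Elements

variable {N : ℕ} [NeZero N]

/-- A unit of `ℤ/N` in the kernel of the reduction to `ℤ/d` on which some character is
non-trivial, when the kernel has at most two elements `{1, t}`: every character NOT factoring
through `d` takes the value `-1` at `t`. [folklore] -/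
theorem apply_eq_neg_one_of_ker_pair {d : ℕ} (hd : d ∣ N) (t : (ZMod N)ˣ)
    (hker : ∀ k : (ZMod N)ˣ, ZMod.unitsMap hd k = 1 → k = 1 ∨ k = t) (ht2 : t * t = 1)
    {χ : DirichletCharacter ℂ N} (hχ : ¬ χ.FactorsThrough d) : χ t = -1 := by
  obtain ⟨k, hk, hχk⟩ := exists_ker_apply_ne_one hd hχ
  rcases hker k hk with rfl | rfl
  · exact absurd (by rw [Units.val_one, map_one]) hχk
  · have hsq : χ (k : ZMod N) * χ (k : ZMod N) = 1 := by
      rw [← map_mul, ← Units.val_mul, ht2, Units.val_one, map_one]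
    rcases mul_self_eq_one_iff.mp hsq with h1 | h1
    · exact absurd h1 hχk
    · exact h1

/-- The kernel of `(ℤ/2d)ˣ → (ℤ/d)ˣ` consists of `1` and `1 + d` (`d ≥ 2`). [folklore] -/
theorem coe_eq_of_unitsMap_eq_one_double {d : ℕ} (hd : d ∣ N) (h2d : d * 2 = N) (hd1 : 1 < d)
    (u : (ZMod N)ˣ) (hu : ZMod.unitsMap hd u = 1) :
    (u : ZMod N) = 1 ∨ (u : ZMod N) = 1 + (d : ZMod N) := by
  haveI : NeZero d := ⟨by omega⟩
  have hu' : ((u : ZMod N).val : ZMod d) = 1 := by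
    have := congrArg (fun z : (ZMod d)ˣ ↦ (z : ZMod d)) hu
    simp only [ZMod.unitsMap_val, Units.val_one] at this
    rwa [ZMod.cast_eq_val] at this
  rw [show (1 : ZMod d) = ((1 : ℕ) : ZMod d) by norm_cast, ZMod.natCast_eq_natCast_iff'] at hu'
  have hlt : (u : ZMod N).val < N := ZMod.val_lt _
  rw [Nat.mod_eq_of_lt hd1] at hu'
  have hdecomp := Nat.mod_add_div (u : ZMod N).val d
  rw [hu'] at hdecomp
  have hj : (u : ZMod N).val / d < 2 := by
    apply Nat.div_lt_of_lt_mul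
    calc (u : ZMod N).val < N := hlt
      _ = d * 2 := h2d.symm
  interval_cases hjj : (u : ZMod N).val / d
  · left
    rw [← ZMod.natCast_zmod_val (u : ZMod N), ← hdecomp]
    simp
  · right
    rw [← ZMod.natCast_zmod_val (u : ZMod N), ← hdecomp]
    push_cast
    ring

/-- **`χ(1 + N/2) = -1` for every primitive character mod `N`, `4 ∣ N`**: `1 + N/2` is the
non-trivial element of `ker((ℤ/N)ˣ → (ℤ/(N/2))ˣ)` and squares to `1`; so `χ(N/2 - 1) = -χ(-1)`
(`N/2 - 1 = u₋₁` of [Aoki1983, §6]). [cite: Aoki1983, §6 (u_ε ∈ U(m))] -/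
theorem apply_one_add_half (h4 : 4 ∣ N) {χ : DirichletCharacter ℂ N} (hχ : χ.IsPrimitive) :
    χ (1 + ((N / 2 : ℕ) : ZMod N)) = -1 := by
  have hN0 : N ≠ 0 := NeZero.ne N
  obtain ⟨k, hk⟩ := h4
  have hN2 : N / 2 = 2 * k := by rw [hk]; omega
  have hhalf : (N / 2 : ℕ) ∣ N := Nat.div_dvd_of_dvd (dvd_trans (by norm_num) ⟨k, hk⟩)
  -- `(1 + N/2)^2 = 1`
  have hsq0 : ((N / 2 : ℕ) : ZMod N) * ((N / 2 : ℕ) : ZMod N) = 0 := by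
    rw [← Nat.cast_mul, ZMod.natCast_eq_zero_iff, hN2, hk]
    exact ⟨k, by ring⟩
  have h2half : (2 : ZMod N) * ((N / 2 : ℕ) : ZMod N) = 0 := by
    rw [show (2 : ZMod N) = ((2 : ℕ) : ZMod N) by norm_cast, ← Nat.cast_mul,
      ZMod.natCast_eq_zero_iff, Nat.mul_div_cancel' (dvd_trans (by norm_num) ⟨k, hk⟩)]
  have hsq : (1 + ((N / 2 : ℕ) : ZMod N)) * (1 + ((N / 2 : ℕ) : ZMod N)) = 1 := by
    linear_combination hsq0 + h2half
  have hunit : IsUnit (1 + ((N / 2 : ℕ) : ZMod N)) := IsUnit.of_mul_eq_one _ hsq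
  set t := hunit.unit with ht
  have htval : (t : ZMod N) = 1 + ((N / 2 : ℕ) : ZMod N) := hunit.unit_spec
  have htt : t * t = 1 := Units.ext (by rw [Units.val_mul, htval, hsq, Units.val_one])
  -- the kernel of the reduction to `N/2` is `{1, t}`
  haveI : NeZero (N / 2) := ⟨by omega⟩
  have hker : ∀ u : (ZMod N)ˣ, ZMod.unitsMap hhalf u = 1 → u = 1 ∨ u = t := by
    intro u hu
    rcases coe_eq_of_unitsMap_eq_one_double hhalf (by omega) (by omega) u hu with h1 | h1
    · exact Or.inl (Units.ext h1)
    · exact Or.inr (Units.ext (by rw [h1, htval]))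
  have hnf : ¬ χ.FactorsThrough (N / 2) :=
    not_factorsThrough_of_isPrimitive hhalf (by omega) hχ
  rw [← htval]
  exact apply_eq_neg_one_of_ker_pair hhalf t hker htt hnf

/-- **`χ(u) = -χ(-1)` for `u = N/2 - 1`** (`4 ∣ N`, `χ` primitive); in particular `χ(u) = 1` for
odd `χ` (`u ∈ U(N)`) and `χ(u) = -1` for even `χ`. [cite: Aoki1983, §6 (u_ε ∈ U(m))] -/
theorem apply_half_sub_one (h4 : 4 ∣ N) {χ : DirichletCharacter ℂ N} (hχ : χ.IsPrimitive) :
    χ (((N / 2 : ℕ) : ZMod N) - 1) = -χ (-1) := by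
  have hhalf2 : (2 : ZMod N) * ((N / 2 : ℕ) : ZMod N) = 0 := by
    rw [show (2 : ZMod N) = ((2 : ℕ) : ZMod N) by norm_cast, ← Nat.cast_mul,
      ZMod.natCast_eq_zero_iff, Nat.mul_div_cancel' (dvd_trans (by norm_num) h4)]
  have hrew : ((N / 2 : ℕ) : ZMod N) - 1 = (-1) * (1 + ((N / 2 : ℕ) : ZMod N)) := by
    linear_combination hhalf2
  rw [hrew, map_mul, apply_one_add_half h4 hχ]
  ring

/-- **`χ(1 - 2(N/3)²) = -1` for every primitive character mod `N`, `3 ∥ N`**: the element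
`1 - 2(N/3)² ≡ -1 (mod 3), ≡ 1 (mod N/3)` is the non-trivial element of
`ker((ℤ/N)ˣ → (ℤ/(N/3))ˣ)` and squares to `1` (`2(N/3)² - 1 = v₋₁` of [Aoki1983, §6]).
[cite: Aoki1983, §6 (v_δ ∈ U(m))] -/
theorem apply_one_sub_two_mul_third_sq (h3 : 3 ∣ N) (h9 : ¬ 9 ∣ N) {χ : DirichletCharacter ℂ N}
    (hχ : χ.IsPrimitive) : χ (1 - 2 * ((N / 3 : ℕ) : ZMod N) ^ 2) = -1 := by
  have hN0 : N ≠ 0 := NeZero.ne N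
  obtain ⟨k, hk⟩ := h3
  have hN3 : N / 3 = k := by rw [hk]; omega
  have hthird : (N / 3 : ℕ) ∣ N := Nat.div_dvd_of_dvd ⟨k, hk⟩
  have hk3 : ¬ 3 ∣ k := fun ⟨j, hj⟩ ↦ h9 ⟨j, by rw [hk, hj]; ring⟩
  haveI : NeZero (N / 3) := ⟨by rw [hN3]; rintro rfl; omega⟩
  -- `3 (N/3)^2 = 0`, so `(1 - 2 (N/3)^2)^2 = 1 - 4(N/3)^2 + 4 (N/3)^4 = 1 - 4 (N/3)^2 (1 - (N/3)^2)`
  -- and `(N/3)^2 (1 - (N/3)^2)`: use `k^2 ≡ 1 (mod 3)` : `N ∣ (N/3)^2 ((N/3)^2 - 1)`.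
  have hkey : (((N / 3 : ℕ) : ZMod N)) ^ 2 * ((((N / 3 : ℕ) : ZMod N)) ^ 2 - 1) = 0 := by
    -- `k^2 - 1` is divisible by `3`
    have h3k : 3 ∣ k ^ 2 + 2 := by
      rw [← ZMod.natCast_eq_zero_iff]
      push_cast
      have hk0 : (k : ZMod 3) ≠ 0 := by rw [Ne, ZMod.natCast_eq_zero_iff]; exact hk3
      generalize (k : ZMod 3) = y at hk0; revert y; decide
    obtain ⟨j, hj⟩ := h3k
    -- `k^2 (k^2 - 1) = k^2 (k^2 + 2) - 3 k^2 = 3 k^2 j - 3k^2 = N k (j - 1)`-ish; work in `ZMod N`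
    have hN : ((N : ℕ) : ZMod N) = 0 := ZMod.natCast_self N
    rw [hN3]
    have h1 : ((k : ℕ) : ZMod N) ^ 2 + 2 = 3 * (j : ZMod N) := by exact_mod_cast congrArg (Nat.cast (R := ZMod N)) hj
    have h2 : (3 : ZMod N) * (k : ZMod N) = 0 := by
      have : ((3 * k : ℕ) : ZMod N) = 0 := by rw [← hk]; exact ZMod.natCast_self N
      push_cast at this; exact this
    linear_combination ((k : ZMod N) * (j : ZMod N) - (k : ZMod N)) * h2 + ((k : ZMod N)) ^ 2 * h1
  have hsq : (1 - 2 * ((N / 3 : ℕ) : ZMod N) ^ 2) * (1 - 2 * ((N / 3 : ℕ) : ZMod N) ^ 2) = 1 := by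
    linear_combination (4 : ZMod N) * hkey
  have hunit : IsUnit (1 - 2 * ((N / 3 : ℕ) : ZMod N) ^ 2) := IsUnit.of_mul_eq_one _ hsq
  set t := hunit.unit with ht
  have htval : (t : ZMod N) = 1 - 2 * ((N / 3 : ℕ) : ZMod N) ^ 2 := hunit.unit_spec
  have htt : t * t = 1 := Units.ext (by rw [Units.val_mul, htval, hsq, Units.val_one])
  -- reductions of `t`: `1` mod `N/3`
  have htmod : ((t : ZMod N).cast : ZMod (N / 3)) = 1 := by
    rw [htval, ← ZMod.castHom_apply (h := hthird), map_sub, map_one, map_mul, map_pow,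
      map_natCast, map_ofNat, ZMod.natCast_self, zero_pow two_ne_zero, mul_zero, sub_zero]
  -- the kernel of the reduction to `N/3` is `{1, t}`: an element `≡ 1 (mod N/3)` is determined
  -- by its residue mod `3`
  have hker : ∀ u : (ZMod N)ˣ, ZMod.unitsMap hthird u = 1 → u = 1 ∨ u = t := by
    intro u hu
    have hu' : ((u : ZMod N).cast : ZMod (N / 3)) = 1 := by
      have := congrArg (fun z : (ZMod (N / 3))ˣ ↦ (z : ZMod (N / 3))) hu
      simpa [ZMod.unitsMap_val] using this
    -- compare `u` with `1` and with `t` through the residues mod `N/3` and mod `3`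
    have h33 : (3 : ℕ) ∣ N := ⟨k, hk⟩
    have hcop : Nat.Coprime (N / 3) 3 := by
      rw [hN3]; exact (Nat.coprime_comm).mp ((Nat.Prime.coprime_iff_not_dvd Nat.prime_three).mpr hk3)
    -- residues mod 3 of units are `1` or `2 = -1`
    have hres : ∀ x : (ZMod N)ˣ, ((x : ZMod N).cast : ZMod 3) = 1 ∨ ((x : ZMod N).cast : ZMod 3) = -1 := by
      intro x
      have hxu : IsUnit (((x : ZMod N).cast : ZMod 3)) := by
        rw [← ZMod.castHom_apply (h := h33)]
        exact (Units.isUnit x).map _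
      generalize ((x : ZMod N).cast : ZMod 3) = y at hxu
      revert y
      decide
    have ht3 : ((t : ZMod N).cast : ZMod 3) = -1 := by
      rw [htval, ← ZMod.castHom_apply (h := h33), map_sub, map_one, map_mul, map_pow,
        map_natCast, hN3]
      have : ((k : ℕ) : ZMod 3) ^ 2 = 1 := by
        have hk12 : k % 3 = 1 ∨ k % 3 = 2 := by omega
        rw [← ZMod.natCast_mod k 3]
        rcases hk12 with h1 | h1 <;> rw [h1] <;> decide
      rw [map_ofNat, this]
      decide
    -- `x ↦ (x mod N/3, x mod 3)` is injective on `ℤ/N` (`N = (N/3)·3` coprime)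
    have hinj : ∀ x y : ZMod N, (x.cast : ZMod (N / 3)) = (y.cast : ZMod (N / 3)) →
        (x.cast : ZMod 3) = (y.cast : ZMod 3) → x = y := by
      intro x y h1 h2
      have hsub1 : ((x - y).cast : ZMod (N / 3)) = 0 := by
        rw [← ZMod.castHom_apply (h := hthird), map_sub, ZMod.castHom_apply, ZMod.castHom_apply, h1, sub_self]
      have hsub2 : ((x - y).cast : ZMod 3) = 0 := by
        rw [← ZMod.castHom_apply (h := h33), map_sub, ZMod.castHom_apply, ZMod.castHom_apply, h2, sub_self]
      rw [ZMod.cast_eq_val, ZMod.natCast_eq_zero_iff] at hsub1 hsub2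
      have hN' : N ∣ (x - y).val := by
        have := Nat.Coprime.mul_dvd_of_dvd_of_dvd hcop hsub1 hsub2
        rwa [Nat.div_mul_cancel h33] at this
      have : (x - y) = 0 := by
        rw [← ZMod.natCast_zmod_val (x - y), (ZMod.natCast_eq_zero_iff _ _).mpr hN']
      exact sub_eq_zero.mp this
    rcases hres u with h1 | h1
    · left
      exact Units.ext (hinj _ _ (by rw [hu', Units.val_one, ZMod.cast_one hthird])
        (by rw [h1, Units.val_one, ZMod.cast_one h33]))
    · right
      exact Units.ext (hinj _ _ (by rw [hu', htmod]) (by rw [h1, ht3]))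
  have hnf : ¬ χ.FactorsThrough (N / 3) := by
    refine not_factorsThrough_of_isPrimitive hthird ?_ hχ
    rw [hN3, hk]; omega
  rw [← htval]
  exact apply_eq_neg_one_of_ker_pair hthird t hker htt hnf

/-- **`χ(v) = -χ(-1)` for `v = 2(N/3)² - 1`** (`3 ∥ N`, `χ` primitive); so `v ∈ U(N)`.
[cite: Aoki1983, §6 (v_δ ∈ U(m))] -/
theorem apply_two_mul_third_sq_sub_one (h3 : 3 ∣ N) (h9 : ¬ 9 ∣ N)
    {χ : DirichletCharacter ℂ N} (hχ : χ.IsPrimitive) :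
    χ (2 * ((N / 3 : ℕ) : ZMod N) ^ 2 - 1) = -χ (-1) := by
  rw [show (2 * ((N / 3 : ℕ) : ZMod N) ^ 2 - 1) = (-1) * (1 - 2 * ((N / 3 : ℕ) : ZMod N) ^ 2) by ring,
    map_mul, apply_one_sub_two_mul_third_sq h3 h9 hχ]
  ring

end Elements


/-! ### Local conclusion at a free odd prime power; passing to the cofactor -/

section OddPrimePow

variable {q n : ℕ} [NeZero q] [NeZero n]

/-- `φ(d) · #ker((ℤ/q)ˣ → (ℤ/d)ˣ) = φ(q)`. [folklore] -/
theorem totient_mul_card_ker {d : ℕ} (hd : d ∣ q) :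
    d.totient * #(univ.filter fun u : (ZMod q)ˣ ↦ ZMod.unitsMap hd u = 1) = q.totient := by
  classical
  have hd0 : d ≠ 0 := by rintro rfl; exact NeZero.ne q (zero_dvd_iff.mp hd)
  haveI : NeZero d := ⟨hd0⟩
  rw [← totient_mul_card_fiber (m := q) hd isUnit_one]
  congr 1
  refine Finset.card_bij (fun u _ ↦ (u : ZMod q)) (fun u hu ↦ ?_) (fun u₁ _ u₂ _ h ↦ Units.ext h)
    (fun x hx ↦ ?_)
  · simp only [mem_filter, mem_univ, true_and] at hu ⊢
    exact ⟨Units.isUnit u, by rw [← coe_unitsMap, hu, Units.val_one]⟩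
  · simp only [mem_filter, mem_univ, true_and] at hx
    refine ⟨hx.1.unit, ?_, hx.1.unit_spec⟩
    simp only [mem_filter, mem_univ, true_and]
    apply Units.ext
    rw [coe_unitsMap, hx.1.unit_spec, hx.2, Units.val_one]

/-- `#ker((ℤ/p^e)ˣ → (ℤ/p^(e-1))ˣ) = p` for `e ≥ 2`. [folklore] -/
theorem card_ker_primePow {p e : ℕ} (hp : p.Prime) (he : 2 ≤ e) :
    haveI : NeZero (p ^ e) := ⟨pow_ne_zero e hp.ne_zero⟩
    #(univ.filter fun u : (ZMod (p ^ e))ˣ ↦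
      ZMod.unitsMap (pow_dvd_pow p (Nat.sub_le e 1)) u = 1) = p := by
  classical
  haveI : NeZero (p ^ e) := ⟨pow_ne_zero e hp.ne_zero⟩
  have h := totient_mul_card_ker (q := p ^ e) (pow_dvd_pow p (Nat.sub_le e 1))
  rw [Nat.totient_prime_pow hp (by omega), Nat.totient_prime_pow hp (by omega)] at h
  have hp1 : 0 < p - 1 := by have := hp.two_le; omega
  have hpow : p ^ (e - 1 - 1) * p = p ^ (e - 1) := by
    rw [← pow_succ]; congr 1; omega
  have hpos : 0 < p ^ (e - 1 - 1) * (p - 1) := Nat.mul_pos (pow_pos hp.pos _) hp1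
  apply Nat.eq_of_mul_eq_mul_left hpos
  rw [h, ← hpow]
  ring

omit [NeZero q] in
/-- `-1 ∉ ker((ℤ/q)ˣ → (ℤ/d)ˣ)` for `d > 2`. [folklore] -/
theorem unitsMap_neg_one_ne_one {d : ℕ} (hd : d ∣ q) (hd2 : 2 < d) :
    ZMod.unitsMap hd (-1 : (ZMod q)ˣ) ≠ 1 := by
  haveI : NeZero d := ⟨by omega⟩
  haveI : Fact (2 < d) := ⟨hd2⟩
  intro h
  have := congrArg (fun z : (ZMod d)ˣ ↦ (z : ZMod d)) h
  simp only [Units.val_one] at this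
  rw [coe_unitsMap, Units.val_neg, Units.val_one, map_neg, map_one] at this
  exact ZMod.neg_one_ne_one this

/-- **Local conclusion at a free odd prime power** ([Aoki1983, Prop. 6.1, Step A]): for
`f = p^e · n` (`p` odd, `p^e ≠ 3`, `n` odd or `4 ∣ n`, and `n ∉ {3, 4}` when `p^e = 5`) and
`w ∈ U(f)`: `w ≡ ±1 (mod p^e)`. [cite: Aoki1983, Prop. 6.1] -/
theorem unitsMap_eq_pm_one_of_odd_primePow {p e : ℕ} (hp : p.Prime) (hp2 : p ≠ 2) (he : 1 ≤ e)
    (h3 : p ^ e ≠ 3) [NeZero (p ^ e)] (hcop : (p ^ e).Coprime n) (hn : Odd n ∨ 4 ∣ n)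
    (h5 : p ^ e = 5 → n ≠ 3 ∧ n ≠ 4) (w : (ZMod (p ^ e * n))ˣ)
    (hw : ∀ χ : DirichletCharacter ℂ (p ^ e * n), χ.Odd → χ.IsPrimitive → χ w = 1) :
    ZMod.unitsMap (dvd_mul_right (p ^ e) n) w = 1 ∨
      ZMod.unitsMap (dvd_mul_right (p ^ e) n) w = -1 := by
  classical
  haveI : NeZero (p ^ e * n) := ⟨mul_ne_zero (NeZero.ne (p ^ e)) (NeZero.ne n)⟩
  have hp3 : 3 ≤ p := by
    have := hp.two_le
    rcases Nat.lt_or_ge 2 p with h | h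
    · omega
    · exact absurd (le_antisymm h hp.two_le) hp2
  have hpodd : Odd p := hp.odd_of_ne_two hp2
  have hqodd : Odd (p ^ e) := hpodd.pow
  have hq3 : 3 ≤ p ^ e := le_trans hp3 (Nat.le_self_pow (by omega) p)
  have hval : Odd (p ^ e * n) ∨ 4 ∣ p ^ e * n :=
    hn.imp (fun h ↦ hqodd.mul h) (fun h ↦ dvd_mul_of_dvd_right h _)
  have hf1 : p ^ e * n ≠ 1 := by
    intro h1
    have := Nat.eq_one_of_mul_eq_one_right h1
    omega
  have hf12 : p ^ e * n ≠ 12 := by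
    intro h12
    have hpdvd : p ∣ 4 * 3 := by
      rw [show 4 * 3 = p ^ e * n from by rw [h12]]
      exact dvd_trans (dvd_pow_self p (by omega)) (dvd_mul_right _ _)
    rcases (Nat.Prime.dvd_mul hp).mp hpdvd with h4 | h3'
    · have : p ∣ 2 := hp.dvd_of_dvd_pow (show p ∣ 2 ^ 2 by simpa using h4)
      have := Nat.le_of_dvd (by norm_num) this
      omega
    · have hp3' : p = 3 := (Nat.prime_dvd_prime_iff_eq hp Nat.prime_three).mp h3'
      subst hp3'
      rcases Nat.lt_or_ge e 2 with he2 | he2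
      · interval_cases e
        exact h3 rfl
      · have : 9 ∣ 12 := by
          rw [← h12]
          exact dvd_trans (pow_dvd_pow 3 he2) (dvd_mul_right _ _)
        omega
  have hPC : ∃ χ : DirichletCharacter ℂ (p ^ e * n), χ.Odd ∧ χ.IsPrimitive :=
    exists_odd_isPrimitive hval hf1 hf12
  rcases Nat.lt_or_ge e 2 with he2 | he2
  · -- `e = 1`
    interval_cases e
    have hq : (p ^ 1).Prime := by rw [pow_one]; exact hp
    have hq5 : 5 ≤ p ^ 1 := by
      rw [pow_one] at h3 ⊢
      rcases hpodd with ⟨k, rfl⟩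
      omega
    by_cases hn34 : n = 3 ∨ n = 4
    · have hq7 : 7 ≤ p ^ 1 := by
        have hne5 : p ^ 1 ≠ 5 := fun h ↦ by
          obtain ⟨h3', h4'⟩ := h5 h
          rcases hn34 with rfl | rfl
          · exact h3' rfl
          · exact h4' rfl
        rw [pow_one] at hq5 hne5 ⊢
        rcases hpodd with ⟨k, rfl⟩
        omega
      exact unitsMap_eq_pm_one_of_prime_seven hcop hq hq7 hPC w hw
    · rw [not_or] at hn34
      exact unitsMap_eq_pm_one_of_prime hcop hq hq5 (exists_even_isPrimitive hn hn34.1 hn34.2)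
        hPC w hw
  · -- `e ≥ 2`: the kernel of the reduction to `p^(e-1)`
    have hd : p ^ (e - 1) ∣ p ^ e := pow_dvd_pow p (Nat.sub_le e 1)
    have hd3 : 3 ≤ p ^ (e - 1) := le_trans hp3 (Nat.le_self_pow (by omega) p)
    refine unitsMap_eq_pm_one_of_ker hcop (by omega) hd
      (fun χ hχ ↦ isPrimitive_of_not_factorsThrough_primePow hp he χ hχ)
      (unitsMap_neg_one_ne_one hd (by omega)) ?_ hPC w hw
    rw [card_ker_primePow hp he2]
    omega

/-- **Passing to the cofactor**: if `w ∈ U(qn)`, `w ≡ ±1 (mod q)` and `PC⁺(q) ≠ ∅`, then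
`w mod n ∈ U(n)` (test against `χ_q ⊠ χ'` with `χ_q` even primitive). [cite: Aoki1983, Prop. 6.1] -/
theorem forall_odd_isPrimitive_cofactor (h : q.Coprime n)
    (hPCq : ∃ χ₁ : DirichletCharacter ℂ q, χ₁.Even ∧ χ₁.IsPrimitive) (w : (ZMod (q * n))ˣ)
    (hw : ∀ χ : DirichletCharacter ℂ (q * n), χ.Odd → χ.IsPrimitive → χ w = 1)
    (hwq : ZMod.unitsMap (dvd_mul_right q n) w = 1 ∨ ZMod.unitsMap (dvd_mul_right q n) w = -1) :
    ∀ χ₂ : DirichletCharacter ℂ n, χ₂.Odd → χ₂.IsPrimitive →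
      χ₂ ((ZMod.unitsMap (dvd_mul_left n q) w : (ZMod n)ˣ) : ZMod n) = 1 := by
  intro χ₂ hodd hprim
  obtain ⟨χ₁, h1e, h1p⟩ := hPCq
  have key := hw _ (prodChar_odd_of_even_odd h1e hodd) (prodChar_isPrimitive h h1p hprim)
  rw [prodChar_apply] at key
  have hq1 : χ₁ (ZMod.castHom (dvd_mul_right q n) (ZMod q) (w : ZMod (q * n))) = 1 := by
    rw [← coe_unitsMap]
    rcases hwq with h' | h'
    · rw [h', Units.val_one, map_one]
    · rw [h', Units.val_neg, Units.val_one]; exact h1e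
  rwa [hq1, one_mul, ← coe_unitsMap] at key

end OddPrimePow


/-! ### The induction step of Prop. 6.1 at an odd free prime power -/

section Step

variable {q n : ℕ} [NeZero q] [NeZero n]

omit [NeZero q] [NeZero n] in
/-- `qn/2 ≡ 0 (mod q)` when `2 ∣ n`. [folklore] -/
theorem castHom_left_half (h2 : 2 ∣ n) :
    ZMod.castHom (dvd_mul_right q n) (ZMod q) (((q * n / 2 : ℕ) : ZMod (q * n))) = 0 := by
  rw [map_natCast, Nat.mul_div_assoc q h2, Nat.cast_mul, ZMod.natCast_self, zero_mul]

omit [NeZero q] [NeZero n] in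
/-- `qn/2 ≡ n/2 (mod n)` for `q` odd, `2 ∣ n`. [folklore] -/
theorem castHom_right_half (hq : Odd q) (h2 : 2 ∣ n) :
    ZMod.castHom (dvd_mul_left n q) (ZMod n) (((q * n / 2 : ℕ) : ZMod (q * n))) =
      ((n / 2 : ℕ) : ZMod n) := by
  rw [map_natCast]
  obtain ⟨k, rfl⟩ := h2
  obtain ⟨a, rfl⟩ := hq
  have h1 : (2 * a + 1) * (2 * k) / 2 = a * (2 * k) + k := by
    rw [show (2 * a + 1) * (2 * k) = 2 * (a * (2 * k) + k) by ring,
      Nat.mul_div_cancel_left _ two_pos]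
  rw [h1, Nat.mul_div_cancel_left k two_pos, Nat.cast_add, Nat.cast_mul, ZMod.natCast_self,
    mul_zero, zero_add]

omit [NeZero q] [NeZero n] in
/-- `qn/3 ≡ 0 (mod q)` when `3 ∣ n`. [folklore] -/
theorem castHom_left_third (h3 : 3 ∣ n) :
    ZMod.castHom (dvd_mul_right q n) (ZMod q) (((q * n / 3 : ℕ) : ZMod (q * n))) = 0 := by
  rw [map_natCast, Nat.mul_div_assoc q h3, Nat.cast_mul, ZMod.natCast_self, zero_mul]

omit [NeZero q] [NeZero n] in
/-- `(qn/3)² ≡ (n/3)² (mod n)` for `q` coprime to `3 ∣ n`. [folklore] -/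
theorem castHom_right_third_sq (h : q.Coprime n) (h3 : 3 ∣ n) :
    ZMod.castHom (dvd_mul_left n q) (ZMod n) (((q * n / 3 : ℕ) : ZMod (q * n)) ^ 2) =
      ((n / 3 : ℕ) : ZMod n) ^ 2 := by
  rw [map_pow, map_natCast]
  obtain ⟨k, rfl⟩ := h3
  have hq3 : ¬ 3 ∣ q := fun hd ↦ by
    have := Nat.Coprime.coprime_dvd_right (dvd_mul_right 3 k) (Nat.Coprime.coprime_dvd_left hd h)
    norm_num at this
  have h1 : q * (3 * k) / 3 = q * k := by
    rw [show q * (3 * k) = 3 * (q * k) by ring, Nat.mul_div_cancel_left _ (by norm_num : 0 < 3)]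
  rw [h1, Nat.mul_div_cancel_left k (by norm_num : 0 < 3)]
  have hmod : q ^ 2 % 3 = 1 := by
    have : q % 3 = 1 ∨ q % 3 = 2 := by omega
    rcases this with hm | hm <;> simp [Nat.pow_mod, hm]
  obtain ⟨j, hj⟩ : ∃ j, q ^ 2 = 3 * j + 1 := ⟨q ^ 2 / 3, by omega⟩
  have hj' : ((q : ℕ) : ZMod (3 * k)) ^ 2 = 3 * (j : ZMod (3 * k)) + 1 := by
    exact_mod_cast congrArg (Nat.cast (R := ZMod (3 * k))) hj
  have h0 : (3 : ZMod (3 * k)) * (k : ZMod (3 * k)) = 0 := by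
    exact_mod_cast ZMod.natCast_self (3 * k)
  push_cast
  linear_combination ((k : ZMod (3 * k)) ^ 2) * hj' +
    ((j : ZMod (3 * k)) * (k : ZMod (3 * k))) * h0

omit [NeZero q] [NeZero n] in
/-- `u = qn/2 - 1 ≡ -1 (mod q)` (`q` odd... only `2 ∣ n` is used). [cite: Aoki1983, §6] -/
theorem castHom_left_uElt (h2 : 2 ∣ n) :
    ZMod.castHom (dvd_mul_right q n) (ZMod q) (((q * n / 2 : ℕ) : ZMod (q * n)) - 1) = -1 := by
  rw [map_sub, castHom_left_half h2, map_one, zero_sub]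

omit [NeZero q] [NeZero n] in
/-- `u = qn/2 - 1 ≡ n/2 - 1 (mod n)` for `q` odd. [cite: Aoki1983, §6] -/
theorem castHom_right_uElt (hq : Odd q) (h2 : 2 ∣ n) :
    ZMod.castHom (dvd_mul_left n q) (ZMod n) (((q * n / 2 : ℕ) : ZMod (q * n)) - 1) =
      ((n / 2 : ℕ) : ZMod n) - 1 := by
  rw [map_sub, castHom_right_half hq h2, map_one]

omit [NeZero q] [NeZero n] in
/-- `v = 2(qn/3)² - 1 ≡ -1 (mod q)`. [cite: Aoki1983, §6] -/
theorem castHom_left_vElt (h3 : 3 ∣ n) :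
    ZMod.castHom (dvd_mul_right q n) (ZMod q) (2 * ((q * n / 3 : ℕ) : ZMod (q * n)) ^ 2 - 1) =
      -1 := by
  rw [map_sub, map_mul, map_pow, castHom_left_third h3, map_one, map_ofNat]
  ring

omit [NeZero q] [NeZero n] in
/-- `v = 2(qn/3)² - 1 ≡ 2(n/3)² - 1 (mod n)` (`q` coprime to `3`). [cite: Aoki1983, §6] -/
theorem castHom_right_vElt (h : q.Coprime n) (h3 : 3 ∣ n) :
    ZMod.castHom (dvd_mul_left n q) (ZMod n) (2 * ((q * n / 3 : ℕ) : ZMod (q * n)) ^ 2 - 1) =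
      2 * ((n / 3 : ℕ) : ZMod n) ^ 2 - 1 := by
  rw [map_sub, map_mul, map_ofNat, castHom_right_third_sq h h3, map_one]

/-- **Induction step of [Aoki1983, Prop. 6.1] at an odd free prime power `q`**: if
`w ∈ U(qn)`, `w ≡ ±1 (mod q)`, `PC^±(q) ≠ ∅`, and `w mod n ∈ {1, u', v', u'v'}` (the
conclusion at level `n`), then `w ∈ {1, u, v, uv}` at level `qn`. [cite: Aoki1983, Prop. 6.1] -/
theorem step_odd (h : q.Coprime n) (hq : Odd q)
    (hPCq' : ∃ χ₁ : DirichletCharacter ℂ q, χ₁.Odd ∧ χ₁.IsPrimitive)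
    (hn : Odd n ∨ 4 ∣ n) (w : (ZMod (q * n))ˣ)
    (hw : ∀ χ : DirichletCharacter ℂ (q * n), χ.Odd → χ.IsPrimitive → χ w = 1)
    (hwq : ZMod.unitsMap (dvd_mul_right q n) w = 1 ∨ ZMod.unitsMap (dvd_mul_right q n) w = -1)
    (hIH : ZMod.castHom (dvd_mul_left n q) (ZMod n) w = 1 ∨
      (4 ∣ n ∧ ZMod.castHom (dvd_mul_left n q) (ZMod n) w = ((n / 2 : ℕ) : ZMod n) - 1) ∨
      (3 ∣ n ∧ ¬ 9 ∣ n ∧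
        ZMod.castHom (dvd_mul_left n q) (ZMod n) w = 2 * ((n / 3 : ℕ) : ZMod n) ^ 2 - 1) ∨
      (4 ∣ n ∧ 3 ∣ n ∧ ¬ 9 ∣ n ∧ ZMod.castHom (dvd_mul_left n q) (ZMod n) w =
        (((n / 2 : ℕ) : ZMod n) - 1) * (2 * ((n / 3 : ℕ) : ZMod n) ^ 2 - 1))) :
    (w : ZMod (q * n)) = 1 ∨
    (4 ∣ q * n ∧ (w : ZMod (q * n)) = ((q * n / 2 : ℕ) : ZMod (q * n)) - 1) ∨
    (3 ∣ q * n ∧ ¬ 9 ∣ q * n ∧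
      (w : ZMod (q * n)) = 2 * ((q * n / 3 : ℕ) : ZMod (q * n)) ^ 2 - 1) ∨
    (4 ∣ q * n ∧ 3 ∣ q * n ∧ ¬ 9 ∣ q * n ∧ (w : ZMod (q * n)) =
      (((q * n / 2 : ℕ) : ZMod (q * n)) - 1) *
        (2 * ((q * n / 3 : ℕ) : ZMod (q * n)) ^ 2 - 1)) := by
  classical
  haveI : NeZero (q * n) := ⟨mul_ne_zero (NeZero.ne q) (NeZero.ne n)⟩
  have hcq : ZMod.castHom (dvd_mul_right q n) (ZMod q) (w : ZMod (q * n)) = 1 ∨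
      ZMod.castHom (dvd_mul_right q n) (ZMod q) (w : ZMod (q * n)) = -1 := by
    rw [← coe_unitsMap]
    rcases hwq with h' | h' <;> rw [h']
    · exact Or.inl Units.val_one
    · right; rw [Units.val_neg, Units.val_one]
  -- divisibility transfer
  have hq3 : 3 ∣ n → ¬ 3 ∣ q := fun h3 hd ↦ by
    have := Nat.Coprime.coprime_dvd_right h3 (Nat.Coprime.coprime_dvd_left hd h)
    norm_num at this
  have h9 : 3 ∣ n → ¬ 9 ∣ n → ¬ 9 ∣ q * n := fun h3 h9n h9 ↦ by
    have hc : Nat.Coprime (3 ^ 2) q :=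
      Nat.Coprime.pow_left 2 ((Nat.Prime.coprime_iff_not_dvd Nat.prime_three).mpr (hq3 h3))
    have hc' : Nat.Coprime 9 q := by norm_num at hc; exact hc
    exact h9n (hc'.dvd_of_dvd_mul_left h9)
  -- the (β) test: odd primitive mod `q` times even primitive mod `n`
  obtain ⟨χ₁, h1o, h1p⟩ := hPCq'
  have hβ : ∀ χ₂ : DirichletCharacter ℂ n, χ₂.Even → χ₂.IsPrimitive →
      χ₁ (ZMod.castHom (dvd_mul_right q n) (ZMod q) (w : ZMod (q * n))) *
        χ₂ (ZMod.castHom (dvd_mul_left n q) (ZMod n) (w : ZMod (q * n))) = 1 := by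
    intro χ₂ h2e h2p
    have := hw _ (prodChar_odd_of_odd_even h1o h2e) (prodChar_isPrimitive h h1p h2p)
    rwa [prodChar_apply] at this
  have hχ₁m : χ₁ (-1) = -1 := h1o
  have hPCn : n ≠ 3 → n ≠ 4 → ∃ χ₂ : DirichletCharacter ℂ n, χ₂.Even ∧ χ₂.IsPrimitive :=
    fun h3 h4 ↦ exists_even_isPrimitive hn h3 h4
  rcases hcq with hcq | hcq
  · -- `w ≡ 1 (mod q)`
    rcases hIH with h1 | ⟨h4n, hu⟩ | ⟨h3n, h9n, hv⟩ | ⟨h4n, h3n, h9n, huv⟩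
    · exact Or.inl (eq_of_cast_eq_of_coprime h (by rw [hcq, map_one]) (by rw [h1, map_one]))
    · by_cases hn4 : n = 4
      · subst hn4
        left
        refine eq_of_cast_eq_of_coprime h (by rw [hcq, map_one]) ?_
        rw [hu, map_one]; decide
      · exfalso
        have hn3 : n ≠ 3 := by rintro rfl; norm_num at h4n
        obtain ⟨χ₂, h2e, h2p⟩ := hPCn hn3 hn4
        have := hβ χ₂ h2e h2p
        rw [hcq, hu, map_one, apply_half_sub_one h4n h2p, h2e] at this
        norm_num at this
    · by_cases hn3 : n = 3
      · subst hn3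
        left
        refine eq_of_cast_eq_of_coprime h (by rw [hcq, map_one]) ?_
        rw [hv, map_one]; decide
      · exfalso
        have hn4 : n ≠ 4 := by rintro rfl; norm_num at h3n
        obtain ⟨χ₂, h2e, h2p⟩ := hPCn hn3 hn4
        have := hβ χ₂ h2e h2p
        rw [hcq, hv, map_one, apply_two_mul_third_sq_sub_one h3n h9n h2p, h2e] at this
        norm_num at this
    · right; right; right
      refine ⟨dvd_mul_of_dvd_right h4n q, dvd_mul_of_dvd_right h3n q, h9 h3n h9n, ?_⟩
      refine eq_of_cast_eq_of_coprime h ?_ ?_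
      · rw [hcq, map_mul, castHom_left_uElt (dvd_trans ⟨2, rfl⟩ h4n), castHom_left_vElt h3n]
        ring
      · rw [huv, map_mul, castHom_right_uElt hq (dvd_trans ⟨2, rfl⟩ h4n),
          castHom_right_vElt h h3n]
  · -- `w ≡ -1 (mod q)`
    rcases hIH with h1 | ⟨h4n, hu⟩ | ⟨h3n, h9n, hv⟩ | ⟨h4n, h3n, h9n, huv⟩
    · by_cases hn3 : n = 3
      · subst hn3
        right; right; left
        refine ⟨dvd_mul_left 3 q, h9 (dvd_refl 3) (by norm_num), eq_of_cast_eq_of_coprime h ?_ ?_⟩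
        · rw [hcq, castHom_left_vElt (dvd_refl 3)]
        · rw [h1, castHom_right_vElt h (dvd_refl 3)]; decide
      by_cases hn4 : n = 4
      · subst hn4
        right; left
        refine ⟨dvd_mul_left 4 q, eq_of_cast_eq_of_coprime h ?_ ?_⟩
        · rw [hcq, castHom_left_uElt ⟨2, rfl⟩]
        · rw [h1, castHom_right_uElt hq ⟨2, rfl⟩]; decide
      exfalso
      obtain ⟨χ₂, h2e, h2p⟩ := hPCn hn3 hn4
      have := hβ χ₂ h2e h2p
      rw [hcq, h1, hχ₁m, map_one] at this
      norm_num at this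
    · right; left
      refine ⟨dvd_mul_of_dvd_right h4n q, eq_of_cast_eq_of_coprime h ?_ ?_⟩
      · rw [hcq, castHom_left_uElt (dvd_trans ⟨2, rfl⟩ h4n)]
      · rw [hu, castHom_right_uElt hq (dvd_trans ⟨2, rfl⟩ h4n)]
    · right; right; left
      refine ⟨dvd_mul_of_dvd_right h3n q, h9 h3n h9n, eq_of_cast_eq_of_coprime h ?_ ?_⟩
      · rw [hcq, castHom_left_vElt h3n]
      · rw [hv, castHom_right_vElt h h3n]
    · exfalso
      have hn3 : n ≠ 3 := by rintro rfl; norm_num at h4n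
      have hn4 : n ≠ 4 := by rintro rfl; norm_num at h3n
      obtain ⟨χ₂, h2e, h2p⟩ := hPCn hn3 hn4
      have := hβ χ₂ h2e h2p
      rw [hcq, huv, hχ₁m, map_mul, apply_half_sub_one h4n h2p,
        apply_two_mul_third_sq_sub_one h3n h9n h2p, h2e] at this
      norm_num at this

end Step


/-! ### The `2`-primary branch and the small levels -/

section TwoPow

/-- `2^a n / 2 = 2^(a-1) n` for `a ≥ 1`. [folklore] -/
theorem two_pow_mul_div_two {a n : ℕ} (ha : 1 ≤ a) : 2 ^ a * n / 2 = 2 ^ (a - 1) * n := by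
  obtain ⟨b, rfl⟩ : ∃ b, a = b + 1 := ⟨a - 1, by omega⟩
  rw [Nat.add_sub_cancel, show 2 ^ (b + 1) * n = 2 ^ b * n * 2 by ring,
    Nat.mul_div_cancel _ two_pos]

/-- `2^a n / 2 ≡ 2^(a-1) (mod 2^a)` for `n` odd. [folklore] -/
theorem castHom_two_pow_half {a n : ℕ} (ha : 1 ≤ a) (hn : Odd n) :
    ZMod.castHom (dvd_mul_right (2 ^ a) n) (ZMod (2 ^ a))
      (((2 ^ a * n / 2 : ℕ) : ZMod (2 ^ a * n))) = ((2 ^ (a - 1) : ℕ) : ZMod (2 ^ a)) := by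
  rw [map_natCast, two_pow_mul_div_two ha]
  obtain ⟨b, rfl⟩ : ∃ b, a = b + 1 := ⟨a - 1, by omega⟩
  obtain ⟨k, rfl⟩ := hn
  rw [Nat.add_sub_cancel]
  have h0 : ((2 ^ (b + 1) : ℕ) : ZMod (2 ^ (b + 1))) = 0 := ZMod.natCast_self _
  push_cast at h0 ⊢
  linear_combination (k : ZMod (2 ^ (b + 1))) * h0

/-- `2^a n / 2 ≡ 0 (mod n)`. [folklore] -/
theorem castHom_two_pow_half_right {a n : ℕ} (ha : 1 ≤ a) :
    ZMod.castHom (dvd_mul_left n (2 ^ a)) (ZMod n)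
      (((2 ^ a * n / 2 : ℕ) : ZMod (2 ^ a * n))) = 0 := by
  rw [map_natCast, two_pow_mul_div_two ha, Nat.cast_mul, ZMod.natCast_self, mul_zero]

/-- `u = 2^a n/2 - 1 ≡ -(1 + 2^(a-1)) (mod 2^a)` for `n` odd. [cite: Aoki1983, §6] -/
theorem castHom_two_pow_uElt {a n : ℕ} (ha : 1 ≤ a) (hn : Odd n) :
    ZMod.castHom (dvd_mul_right (2 ^ a) n) (ZMod (2 ^ a))
      (((2 ^ a * n / 2 : ℕ) : ZMod (2 ^ a * n)) - 1) =
      -(1 + ((2 ^ (a - 1) : ℕ) : ZMod (2 ^ a))) := by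
  rw [map_sub, castHom_two_pow_half ha hn, map_one]
  have h22 : (2 : ZMod (2 ^ a)) * ((2 ^ (a - 1) : ℕ) : ZMod (2 ^ a)) = 0 := by
    rw [show (2 : ZMod (2 ^ a)) = ((2 : ℕ) : ZMod (2 ^ a)) by norm_cast, ← Nat.cast_mul,
      show 2 * 2 ^ (a - 1) = 2 ^ a from by rw [← pow_succ']; congr 1; omega, ZMod.natCast_self]
  linear_combination h22

/-- **The `2`-primary class** ([Aoki1983, Cor. 3.4 / (8.1)]): for `w ∈ U(2^a n)` (`a ≥ 2`),
`w ≡ ±1, ±(1 + 2^(a-1)) (mod 2^a)`. [cite: Aoki1983, Cor. 3.4] -/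
theorem castHom_two_pow_mem {a n : ℕ} [NeZero n] (ha : 2 ≤ a) (hcop : (2 ^ a).Coprime n)
    (hPC : ∃ χ : DirichletCharacter ℂ (2 ^ a * n), χ.Odd ∧ χ.IsPrimitive)
    (w : (ZMod (2 ^ a * n))ˣ)
    (hw : ∀ χ : DirichletCharacter ℂ (2 ^ a * n), χ.Odd → χ.IsPrimitive → χ w = 1) :
    ZMod.castHom (dvd_mul_right (2 ^ a) n) (ZMod (2 ^ a)) w = 1 ∨
    ZMod.castHom (dvd_mul_right (2 ^ a) n) (ZMod (2 ^ a)) w = -1 ∨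
    ZMod.castHom (dvd_mul_right (2 ^ a) n) (ZMod (2 ^ a)) w =
      1 + ((2 ^ (a - 1) : ℕ) : ZMod (2 ^ a)) ∨
    ZMod.castHom (dvd_mul_right (2 ^ a) n) (ZMod (2 ^ a)) w =
      -(1 + ((2 ^ (a - 1) : ℕ) : ZMod (2 ^ a))) := by
  haveI : NeZero (2 ^ a) := ⟨pow_ne_zero a two_ne_zero⟩
  have hd : 2 ^ (a - 1) ∣ 2 ^ a := pow_dvd_pow 2 (Nat.sub_le a 1)
  have hdq : 2 ^ (a - 1) ≠ 2 ^ a := fun h ↦ by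
    have := Nat.pow_right_injective (le_refl 2) h; omega
  obtain ⟨u, hu, hwu⟩ := exists_ker_unitsMap_eq_pm_of_class hcop hd hdq
    (fun χ hχ ↦ isPrimitive_of_not_factorsThrough_primePow Nat.prime_two (by omega) χ hχ)
    hPC w hw
  have hu2 := coe_eq_of_unitsMap_eq_one_double (N := 2 ^ a) hd
    (by rw [← pow_succ]; congr 1; omega)
    (lt_of_lt_of_le one_lt_two (Nat.le_self_pow (by omega) 2)) u hu
  rw [← coe_unitsMap]
  rcases hwu with h1 | h1 <;> rw [h1] <;> rcases hu2 with h2 | h2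
  · exact Or.inl h2
  · exact Or.inr (Or.inr (Or.inl h2))
  · right; left; rw [Units.val_neg, h2]
  · right; right; right; rw [Units.val_neg, h2]

/-- A power `2^a` (`a ≥ 1`) is not odd. [folklore] -/
theorem two_pow_ne_of_odd {a k : ℕ} (ha : 1 ≤ a) (hk : Odd k) : 2 ^ a ≠ k := fun h ↦ by
  have : 2 ∣ k := h ▸ dvd_pow_self 2 (by omega)
  exact (Nat.not_even_iff_odd.mpr hk) (even_iff_two_dvd.mpr this)

/-- **`U(2^a) = {1, 2^(a-1) - 1}`** (`a ≥ 3`), at level `2^a · 1`. [cite: Aoki1983, Prop. 6.1 (i)] -/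
theorem coe_eq_two_pow_one {a : ℕ} (ha : 3 ≤ a) (w : (ZMod (2 ^ a * 1))ˣ)
    (hw : ∀ χ : DirichletCharacter ℂ (2 ^ a * 1), χ.Odd → χ.IsPrimitive → χ w = 1) :
    (w : ZMod (2 ^ a * 1)) = 1 ∨
    (4 ∣ 2 ^ a * 1 ∧ (w : ZMod (2 ^ a * 1)) = ((2 ^ a * 1 / 2 : ℕ) : ZMod (2 ^ a * 1)) - 1) ∨
    (3 ∣ 2 ^ a * 1 ∧ ¬ 9 ∣ 2 ^ a * 1 ∧
      (w : ZMod (2 ^ a * 1)) = 2 * ((2 ^ a * 1 / 3 : ℕ) : ZMod (2 ^ a * 1)) ^ 2 - 1) ∨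
    (4 ∣ 2 ^ a * 1 ∧ 3 ∣ 2 ^ a * 1 ∧ ¬ 9 ∣ 2 ^ a * 1 ∧ (w : ZMod (2 ^ a * 1)) =
      (((2 ^ a * 1 / 2 : ℕ) : ZMod (2 ^ a * 1)) - 1) *
        (2 * ((2 ^ a * 1 / 3 : ℕ) : ZMod (2 ^ a * 1)) ^ 2 - 1)) := by
  classical
  haveI : NeZero (2 ^ a) := ⟨pow_ne_zero a two_ne_zero⟩
  haveI : NeZero (2 ^ a * 1) := ⟨mul_ne_zero (NeZero.ne _) one_ne_zero⟩
  have hcop : (2 ^ a).Coprime 1 := Nat.coprime_one_right _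
  have h4a : 4 ∣ 2 ^ a := by
    have := pow_dvd_pow 2 (show 2 ≤ a by omega); rwa [show (2 : ℕ) ^ 2 = 4 by norm_num] at this
  have h4 : 4 ∣ 2 ^ a * 1 := dvd_mul_of_dvd_left h4a 1
  have h2a : (2 : ℕ) ^ a ≠ 2 := fun h ↦ by
    have := Nat.pow_right_injective (le_refl 2) (h.trans (pow_one 2).symm); omega
  have h12 : 2 ^ a * 1 ≠ 12 := fun h ↦ by
    have h3 : 3 ∣ 2 ^ a := ⟨4, by omega⟩
    have := Nat.Prime.dvd_of_dvd_pow Nat.prime_three h3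
    omega
  have hPC : ∃ χ : DirichletCharacter ℂ (2 ^ a * 1), χ.Odd ∧ χ.IsPrimitive :=
    exists_odd_isPrimitive (Or.inr h4)
      (by rw [mul_one]; exact two_pow_ne_of_odd (by omega) (by decide)) h12
  have hc := castHom_two_pow_mem (by omega) hcop hPC w hw
  -- the test character `χ₂ ⊠ 1`, `χ₂` odd primitive mod `2^a`
  obtain ⟨χ₂, h2o, h2p⟩ := exists_odd_isPrimitive_local Nat.prime_two (by omega : 1 ≤ a) h2a
  have h1e : (1 : DirichletCharacter ℂ 1).Even := by
    show (1 : DirichletCharacter ℂ 1) (-1) = 1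
    rw [Subsingleton.elim (-1 : ZMod 1) 1, map_one]
  have h1p : (1 : DirichletCharacter ℂ 1).IsPrimitive := by
    rw [DirichletCharacter.isPrimitive_def, DirichletCharacter.conductor_one]
  have key := hw _ (prodChar_odd_of_odd_even h2o h1e) (prodChar_isPrimitive hcop h2p h1p)
  rw [prodChar_apply] at key
  have hone : (1 : DirichletCharacter ℂ 1)
      (ZMod.castHom (dvd_mul_left 1 (2 ^ a)) (ZMod 1) (w : ZMod (2 ^ a * 1))) = 1 := by
    rw [← coe_unitsMap, MulChar.one_apply_coe]
  rw [hone, mul_one] at key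
  have hhalf : 2 ^ a / 2 = 2 ^ (a - 1) := by
    have := two_pow_mul_div_two (n := 1) (show 1 ≤ a by omega); simpa using this
  have hz : χ₂ (1 + ((2 ^ (a - 1) : ℕ) : ZMod (2 ^ a))) = -1 := by
    have := apply_one_add_half (N := 2 ^ a) h4a h2p
    rwa [hhalf] at this
  have h2m : χ₂ (-1) = -1 := h2o
  rcases hc with hc | hc | hc | hc
  · left
    exact eq_of_cast_eq_of_coprime hcop (by rw [hc, map_one]) (Subsingleton.elim _ _)
  · rw [hc, h2m] at key; norm_num at key
  · rw [hc, hz] at key; norm_num at key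
  · right; left
    refine ⟨h4, eq_of_cast_eq_of_coprime hcop ?_ (Subsingleton.elim _ _)⟩
    rw [hc, castHom_two_pow_uElt (by omega) (by decide)]

/-- **`U(3 · 2^a) = {1, u, v, uv}`** (`a ≥ 3`), at level `2^a · 3`. [cite: Aoki1983, Prop. 6.1 (iv)] -/
theorem coe_eq_two_pow_three {a : ℕ} (ha : 3 ≤ a) (w : (ZMod (2 ^ a * 3))ˣ)
    (hw : ∀ χ : DirichletCharacter ℂ (2 ^ a * 3), χ.Odd → χ.IsPrimitive → χ w = 1) :
    (w : ZMod (2 ^ a * 3)) = 1 ∨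
    (4 ∣ 2 ^ a * 3 ∧ (w : ZMod (2 ^ a * 3)) = ((2 ^ a * 3 / 2 : ℕ) : ZMod (2 ^ a * 3)) - 1) ∨
    (3 ∣ 2 ^ a * 3 ∧ ¬ 9 ∣ 2 ^ a * 3 ∧
      (w : ZMod (2 ^ a * 3)) = 2 * ((2 ^ a * 3 / 3 : ℕ) : ZMod (2 ^ a * 3)) ^ 2 - 1) ∨
    (4 ∣ 2 ^ a * 3 ∧ 3 ∣ 2 ^ a * 3 ∧ ¬ 9 ∣ 2 ^ a * 3 ∧ (w : ZMod (2 ^ a * 3)) =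
      (((2 ^ a * 3 / 2 : ℕ) : ZMod (2 ^ a * 3)) - 1) *
        (2 * ((2 ^ a * 3 / 3 : ℕ) : ZMod (2 ^ a * 3)) ^ 2 - 1)) := by
  classical
  haveI : NeZero (2 ^ a) := ⟨pow_ne_zero a two_ne_zero⟩
  haveI : NeZero (2 ^ a * 3) := ⟨mul_ne_zero (NeZero.ne _) three_ne_zero⟩
  have hcop : (2 ^ a).Coprime 3 := Nat.Coprime.pow_left a (by norm_num)
  have h4a : 4 ∣ 2 ^ a := by
    have := pow_dvd_pow 2 (show 2 ≤ a by omega); rwa [show (2 : ℕ) ^ 2 = 4 by norm_num] at this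
  have h4 : 4 ∣ 2 ^ a * 3 := dvd_mul_of_dvd_left h4a 3
  have h3 : 3 ∣ 2 ^ a * 3 := dvd_mul_left 3 _
  have h9 : ¬ 9 ∣ 2 ^ a * 3 := fun h9 ↦ by
    have hc : Nat.Coprime 9 (2 ^ a) := Nat.Coprime.pow_right a (by norm_num)
    have := hc.dvd_of_dvd_mul_left h9
    omega
  have h2a : (2 : ℕ) ^ a ≠ 2 := fun h ↦ by
    have := Nat.pow_right_injective (le_refl 2) (h.trans (pow_one 2).symm); omega
  have h3a : (2 : ℕ) ^ a ≠ 3 := two_pow_ne_of_odd (by omega) (by decide)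
  have h4a' : (2 : ℕ) ^ a ≠ 4 := fun h ↦ by
    have := Nat.pow_right_injective (le_refl 2) (h.trans (show 4 = 2 ^ 2 by norm_num)); omega
  have h12 : 2 ^ a * 3 ≠ 12 := fun h ↦ h4a' (by omega)
  have hPC : ∃ χ : DirichletCharacter ℂ (2 ^ a * 3), χ.Odd ∧ χ.IsPrimitive :=
    exists_odd_isPrimitive (Or.inr h4) (by omega) h12
  have hc := castHom_two_pow_mem (by omega) hcop hPC w hw
  -- residue mod `3`
  have hres : ZMod.castHom (dvd_mul_left 3 (2 ^ a)) (ZMod 3) (w : ZMod (2 ^ a * 3)) = 1 ∨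
      ZMod.castHom (dvd_mul_left 3 (2 ^ a)) (ZMod 3) (w : ZMod (2 ^ a * 3)) = -1 := by
    have h33 : ∀ x y : ZMod 3, x * y = 1 → x = 1 ∨ x = -1 := by decide
    refine h33 _ (ZMod.castHom (dvd_mul_left 3 (2 ^ a)) (ZMod 3) ((w⁻¹ : (ZMod (2 ^ a * 3))ˣ) :
      ZMod (2 ^ a * 3))) ?_
    rw [← map_mul, Units.mul_inv, map_one]
  -- the test character `χ₂ ⊠ χ₃`, `χ₂` even primitive mod `2^a`, `χ₃` odd mod `3`
  obtain ⟨χ₂, h2e, h2p⟩ :=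
    exists_even_isPrimitive_local Nat.prime_two (by omega : 1 ≤ a) h2a h3a h4a'
  obtain ⟨χ₃, h3o, h3p⟩ :=
    exists_odd_isPrimitive (f := 3) (Or.inl (by decide)) (by norm_num) (by norm_num)
  have key := hw _ (prodChar_odd_of_even_odd h2e h3o) (prodChar_isPrimitive hcop h2p h3p)
  rw [prodChar_apply] at key
  have hhalf : 2 ^ a / 2 = 2 ^ (a - 1) := by
    have := two_pow_mul_div_two (n := 1) (show 1 ≤ a by omega); simpa using this
  have hz : χ₂ (1 + ((2 ^ (a - 1) : ℕ) : ZMod (2 ^ a))) = -1 := by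
    have := apply_one_add_half (N := 2 ^ a) h4a h2p
    rwa [hhalf] at this
  have h2m : χ₂ (-1) = 1 := h2e
  have hmz : χ₂ (-(1 + ((2 ^ (a - 1) : ℕ) : ZMod (2 ^ a)))) = -1 := by
    rw [neg_eq_neg_one_mul, map_mul, h2m, hz]; ring
  have h3m : χ₃ (-1) = -1 := h3o
  -- components of `u` and `v`
  have hUq := castHom_two_pow_uElt (n := 3) (show 1 ≤ a by omega) (by decide)
  have hU3 : ZMod.castHom (dvd_mul_left 3 (2 ^ a)) (ZMod 3)
      (((2 ^ a * 3 / 2 : ℕ) : ZMod (2 ^ a * 3)) - 1) = -1 := by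
    rw [map_sub, castHom_two_pow_half_right (show 1 ≤ a by omega), map_one, zero_sub]
  have hVq := castHom_left_vElt (q := 2 ^ a) (n := 3) (dvd_refl 3)
  have hV3 : ZMod.castHom (dvd_mul_left 3 (2 ^ a)) (ZMod 3)
      (2 * ((2 ^ a * 3 / 3 : ℕ) : ZMod (2 ^ a * 3)) ^ 2 - 1) = 1 := by
    rw [castHom_right_vElt hcop (dvd_refl 3)]; decide
  rcases hc with hc | hc | hc | hc <;> rcases hres with hr | hr <;> rw [hc, hr] at key
  · left; exact eq_of_cast_eq_of_coprime hcop (by rw [hc, map_one]) (by rw [hr, map_one])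
  · rw [map_one, h3m] at key; norm_num at key
  · right; right; left
    exact ⟨h3, h9, eq_of_cast_eq_of_coprime hcop (by rw [hc, hVq]) (by rw [hr, hV3])⟩
  · rw [h2m, h3m] at key; norm_num at key
  · rw [hz, map_one] at key; norm_num at key
  · right; right; right
    refine ⟨h4, h3, h9, eq_of_cast_eq_of_coprime hcop ?_ ?_⟩
    · rw [hc, map_mul, hUq, hVq]; ring
    · rw [hr, map_mul, hU3, hV3]; ring
  · rw [hmz, map_one] at key; norm_num at key
  · right; left
    exact ⟨h4, eq_of_cast_eq_of_coprime hcop (by rw [hc, hUq]) (by rw [hr, hU3])⟩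

/-- `U(3) = U(4) = {1}`: a unit `≠ 1` of `ℤ/3` or `ℤ/4` is `-1`, detected by an odd character.
[cite: Aoki1983, Prop. 6.1] -/
theorem coe_eq_one_of_level_three (w : (ZMod 3)ˣ)
    (hw : ∀ χ : DirichletCharacter ℂ 3, χ.Odd → χ.IsPrimitive → χ w = 1) : (w : ZMod 3) = 1 := by
  have h33 : ∀ x y : ZMod 3, x * y = 1 → x = 1 ∨ x = -1 := by decide
  rcases h33 _ _ (show (w : ZMod 3) * ((w⁻¹ : (ZMod 3)ˣ) : ZMod 3) = 1 by
    rw [← Units.val_mul, mul_inv_cancel, Units.val_one]) with h | h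
  · exact h
  · exfalso
    obtain ⟨χ, ho, hp⟩ :=
      exists_odd_isPrimitive (f := 3) (Or.inl (by decide)) (by norm_num) (by norm_num)
    have := hw χ ho hp
    rw [h, ho] at this
    norm_num at this

/-- `U(4) = {1}`. [cite: Aoki1983, Prop. 6.1] -/
theorem coe_eq_one_of_level_four (w : (ZMod 4)ˣ)
    (hw : ∀ χ : DirichletCharacter ℂ 4, χ.Odd → χ.IsPrimitive → χ w = 1) : (w : ZMod 4) = 1 := by
  have h44 : ∀ x y : ZMod 4, x * y = 1 → x = 1 ∨ x = -1 := by decide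
  rcases h44 _ _ (show (w : ZMod 4) * ((w⁻¹ : (ZMod 4)ˣ) : ZMod 4) = 1 by
    rw [← Units.val_mul, mul_inv_cancel, Units.val_one]) with h | h
  · exact h
  · exfalso
    obtain ⟨χ, ho, hp⟩ :=
      exists_odd_isPrimitive (f := 4) (Or.inr (dvd_refl 4)) (by norm_num) (by norm_num)
    have := hw χ ho hp
    rw [h, ho] at this
    norm_num at this

end TwoPow


/-! ### Aoki's Proposition 6.1: `U(f) ⊆ {1, u, v, uv}` -/

section Main

/-- Auxiliary form of `coe_eq_of_forall_odd_isPrimitive` with an explicit `f ≠ 0`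
(for the strong induction). [cite: Aoki1983, Prop. 6.1] -/
theorem coe_eq_of_forall_odd_isPrimitive_aux (f : ℕ) (hf0 : f ≠ 0) (hval : Odd f ∨ 4 ∣ f)
    (h15 : f ≠ 15) (h20 : f ≠ 20) (w : (ZMod f)ˣ)
    (hw : ∀ χ : DirichletCharacter ℂ f, χ.Odd → χ.IsPrimitive → χ w = 1) :
    (w : ZMod f) = 1 ∨
    (4 ∣ f ∧ (w : ZMod f) = ((f / 2 : ℕ) : ZMod f) - 1) ∨
    (3 ∣ f ∧ ¬ 9 ∣ f ∧ (w : ZMod f) = 2 * ((f / 3 : ℕ) : ZMod f) ^ 2 - 1) ∨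
    (4 ∣ f ∧ 3 ∣ f ∧ ¬ 9 ∣ f ∧
      (w : ZMod f) = (((f / 2 : ℕ) : ZMod f) - 1) * (2 * ((f / 3 : ℕ) : ZMod f) ^ 2 - 1)) := by
  classical
  induction f using Nat.strong_induction_on with
  | _ f ih =>
  by_cases hpeel : ∃ p, p.Prime ∧ p ∣ f ∧ p ≠ 2 ∧ (p ≠ 3 ∨ 9 ∣ f) ∧ (5 ∣ f → p = 5)
  · /- peel the odd free prime power `p^e ∥ f` -/
    obtain ⟨p, hp, hpf, hp2, hp39, hp5⟩ := hpeel
    obtain ⟨e, he⟩ : ∃ e, f.factorization p = e := ⟨_, rfl⟩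
    have he1 : 1 ≤ e := he ▸ hp.factorization_pos_of_dvd hf0 hpf
    have hcop0 : Nat.Coprime p (f / p ^ e) := he ▸ Nat.coprime_ordCompl hp hf0
    have he3 : p ^ e ≠ 3 := by
      rcases hp39 with hp3 | h9
      · intro h
        exact hp3 ((Nat.prime_dvd_prime_iff_eq hp Nat.prime_three).mp (h ▸ dvd_pow_self p (by omega)))
      · intro h
        have hp3 : p = 3 :=
          (Nat.prime_dvd_prime_iff_eq hp Nat.prime_three).mp (h ▸ dvd_pow_self p (by omega))
        subst hp3
        have h9' : 3 ^ 2 ∣ f := by norm_num; exact h9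
        have he2 : 2 ≤ e :=
          he ▸ (Nat.Prime.pow_dvd_iff_le_factorization Nat.prime_three hf0).mp h9'
        have h' := pow_dvd_pow 3 he2
        rw [h] at h'
        norm_num at h'
    obtain ⟨n, rfl⟩ : ∃ n, f = p ^ e * n :=
      ⟨f / p ^ e, by rw [← he]; exact (Nat.ordProj_mul_ordCompl_eq_self f p).symm⟩
    have hpe0 : p ^ e ≠ 0 := pow_ne_zero e hp.ne_zero
    have hn0 : n ≠ 0 := fun h ↦ hf0 (by rw [h, mul_zero])
    haveI : NeZero n := ⟨hn0⟩
    haveI : NeZero (p ^ e) := ⟨hpe0⟩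
    have hdiv : p ^ e * n / p ^ e = n := Nat.mul_div_cancel_left n (Nat.pos_of_ne_zero hpe0)
    rw [hdiv] at hcop0
    have hcop : (p ^ e).Coprime n := Nat.Coprime.pow_left e hcop0
    have hpodd : Odd p := hp.odd_of_ne_two hp2
    have hqodd : Odd (p ^ e) := hpodd.pow
    have hq1 : 1 < p ^ e := lt_of_lt_of_le hp.one_lt (Nat.le_self_pow (by omega) p)
    have hlt : n < p ^ e * n := (Nat.lt_mul_iff_one_lt_left (Nat.pos_of_ne_zero hn0)).mpr hq1
    have hnval : Odd n ∨ 4 ∣ n := by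
      rcases hval with ho | h4
      · exact Or.inl (Nat.Odd.of_mul_right ho)
      · right
        have hc : Nat.Coprime (2 ^ 2) (p ^ e) :=
          Nat.Coprime.pow 2 e ((Nat.coprime_primes Nat.prime_two hp).mpr (Ne.symm hp2))
        exact (show Nat.Coprime 4 (p ^ e) by simpa using hc).dvd_of_dvd_mul_left h4
    have h5n : ¬ 5 ∣ n := fun h5 ↦ by
      have hp5' : p = 5 := hp5 (dvd_mul_of_dvd_right h5 _)
      subst hp5'
      have : Nat.Coprime 5 n := Nat.Coprime.coprime_dvd_left (dvd_pow_self 5 (by omega)) hcop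
      exact absurd ((Nat.Prime.coprime_iff_not_dvd Nat.prime_five).mp this) (not_not.mpr h5)
    have hn15 : n ≠ 15 := by rintro rfl; exact h5n (by norm_num)
    have hn20 : n ≠ 20 := by rintro rfl; exact h5n (by norm_num)
    have h5cond : p ^ e = 5 → n ≠ 3 ∧ n ≠ 4 := fun h5 ↦ by
      constructor
      · rintro rfl; exact h15 (by rw [h5])
      · rintro rfl; exact h20 (by rw [h5])
    have h2 : p ^ e ≠ 2 := fun h ↦ (Nat.not_even_iff_odd.mpr hqodd) (by rw [h]; exact even_two)
    have h4 : p ^ e ≠ 4 := fun h ↦ (Nat.not_even_iff_odd.mpr hqodd) (by rw [h]; decide)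
    have hwq := unitsMap_eq_pm_one_of_odd_primePow hp hp2 he1 he3 hcop hnval h5cond w hw
    have hPCq := exists_even_isPrimitive_local hp he1 h2 he3 h4
    have hPCq' := exists_odd_isPrimitive_local hp he1 h2
    have hw' := forall_odd_isPrimitive_cofactor hcop hPCq w hw hwq
    have hIH := ih n hlt hn0 hnval hn15 hn20 (ZMod.unitsMap (dvd_mul_left n (p ^ e)) w) hw'
    rw [coe_unitsMap] at hIH
    exact step_odd hcop hqodd hPCq' hnval w hw hwq hIH
  · /- no odd free prime power: `f = 2^a · t` with `t ∈ {1, 3}` -/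
    push Not at hpeel
    have h5f : ¬ 5 ∣ f := fun h5 ↦
      (hpeel 5 Nat.prime_five h5 (by norm_num) (Or.inl (by norm_num))).2 rfl
    have h3f : ∀ p, p.Prime → p ∣ f → p ≠ 2 → p = 3 ∧ ¬ 9 ∣ f := by
      intro p hp hpf hp2
      by_contra hc
      have : p ≠ 3 ∨ 9 ∣ f := by
        by_cases hp3 : p = 3
        · right; by_contra h9; exact hc ⟨hp3, h9⟩
        · exact Or.inl hp3
      exact h5f (hpeel p hp hpf hp2 this).1
    obtain ⟨a, ha⟩ : ∃ a, f.factorization 2 = a := ⟨_, rfl⟩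
    obtain ⟨t, ht⟩ : ∃ t, f / 2 ^ a = t := ⟨_, rfl⟩
    have hft : f = 2 ^ a * t := by rw [← ht, ← ha]; exact (Nat.ordProj_mul_ordCompl_eq_self f 2).symm
    have ht0 : t ≠ 0 := fun h ↦ hf0 (by rw [hft, h, mul_zero])
    have h2t : ¬ 2 ∣ t := by
      have := Nat.coprime_ordCompl Nat.prime_two hf0
      rw [ha, ht] at this
      exact (Nat.Prime.coprime_iff_not_dvd Nat.prime_two).mp this
    have htf : t ∣ f := ⟨2 ^ a, by rw [hft, mul_comm]⟩
    have ht13 : t = 1 ∨ t = 3 := by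
      have hprime_t : ∀ {d : ℕ}, d.Prime → d ∣ t → d = 3 := fun hd hdt ↦
        (h3f _ hd (dvd_trans hdt htf) (fun h2 ↦ h2t (h2 ▸ hdt))).1
      have ht3 := Nat.eq_prime_pow_of_unique_prime_dvd ht0 hprime_t
      set k := t.primeFactorsList.length with hkdef
      have hk : k ≤ 1 := by
        by_contra hk
        push Not at hk
        have h9t : 9 ∣ t := by
          rw [ht3]
          have := pow_dvd_pow 3 (show 2 ≤ k by omega)
          simpa using this
        have h3t : 3 ∣ t := dvd_trans (by norm_num) h9t
        exact (h3f 3 Nat.prime_three (dvd_trans h3t htf) (by norm_num)).2 (dvd_trans h9t htf)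
      rcases Nat.le_one_iff_eq_zero_or_eq_one.mp hk with h0 | h1
      · left; rw [ht3, h0, pow_zero]
      · right; rw [ht3, h1, pow_one]
    have ha1 : a ≠ 1 := by
      rintro rfl
      rw [hft, pow_one] at hval
      rcases hval with ho | h4
      · exact (Nat.not_even_iff_odd.mpr ho) (even_two_mul t)
      · have : 2 ∣ t := by
          have h4' : 2 * 2 ∣ 2 * t := h4
          exact (Nat.mul_dvd_mul_iff_left two_pos).mp h4'
        exact h2t this
    rcases Nat.lt_or_ge a 3 with ha3 | ha3
    · -- `a ∈ {0, 2}`: `f ∈ {1, 3, 4, 12}`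
      interval_cases a
      · rw [pow_zero, one_mul] at hft
        rcases ht13 with rfl | rfl
        · subst hft
          left; exact Subsingleton.elim _ _
        · subst hft
          left; exact coe_eq_one_of_level_three w hw
      · exact absurd rfl ha1
      · rcases ht13 with rfl | rfl
        · norm_num at hft; subst hft
          left; exact coe_eq_one_of_level_four w hw
        · norm_num at hft; subst hft
          have h12u : ∀ x y : ZMod 12, x * y = 1 → x = 1 ∨ x = 5 ∨ x = 7 ∨ x = 11 := by decide
          rcases h12u _ _ (show (w : ZMod 12) * ((w⁻¹ : (ZMod 12)ˣ) : ZMod 12) = 1 by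
            rw [← Units.val_mul, mul_inv_cancel, Units.val_one]) with h | h | h | h
          · exact Or.inl h
          · right; left; exact ⟨by norm_num, by rw [h]; decide⟩
          · right; right; left; exact ⟨by norm_num, by norm_num, by rw [h]; decide⟩
          · right; right; right; exact ⟨by norm_num, by norm_num, by norm_num, by rw [h]; decide⟩
    · -- `a ≥ 3`: the `2`-primary branch
      rcases ht13 with rfl | rfl
      · subst hft; exact coe_eq_two_pow_one ha3 w hw
      · subst hft; exact coe_eq_two_pow_three ha3 w hw

/-- **[Aoki1983, Prop. 6.1] (necessary direction).** Let `f` be odd or divisible by `4`,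
`f ∉ {15, 20}`, and let `w ∈ (ℤ/f)ˣ` satisfy `χ(w) = 1` for every odd primitive Dirichlet
character `χ` mod `f` (i.e. `w ∈ U(f)`). Then `w = 1`, or `4 ∣ f` and `w = u := f/2 - 1`, or
`3 ∥ f` and `w = v := 2(f/3)² - 1` (`v ≡ 1 (mod 3)`, `v ≡ -1 (mod f/3)`), or `12 ∣ f`, `9 ∤ f`
and `w = uv`. (Aoki's cases (i)–(vi); the printed `v_δ = δm'' + 1` is corrected to the element
`≡ 1 (mod 3), ≡ -1 (mod f/3)`, cf. the module docstring. The levels `15, 20` are genuine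
exceptions: `U(15) ∋ 4`, `U(20) ∋ 3`.) Proof: strong induction on `f`, peeling a free odd
prime power (`step_odd`, `unitsMap_eq_pm_one_of_odd_primePow`), the `2`-primary levels
`2^a`, `3·2^a` (`coe_eq_two_pow_one/three`) and `f ∈ {1, 3, 4, 12}` being treated directly.
[cite: Aoki1983, Prop. 6.1] -/
theorem coe_eq_of_forall_odd_isPrimitive (f : ℕ) [NeZero f] (hval : Odd f ∨ 4 ∣ f)
    (h15 : f ≠ 15) (h20 : f ≠ 20) (w : (ZMod f)ˣ)
    (hw : ∀ χ : DirichletCharacter ℂ f, χ.Odd → χ.IsPrimitive → χ w = 1) :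
    (w : ZMod f) = 1 ∨
    (4 ∣ f ∧ (w : ZMod f) = ((f / 2 : ℕ) : ZMod f) - 1) ∨
    (3 ∣ f ∧ ¬ 9 ∣ f ∧ (w : ZMod f) = 2 * ((f / 3 : ℕ) : ZMod f) ^ 2 - 1) ∨
    (4 ∣ f ∧ 3 ∣ f ∧ ¬ 9 ∣ f ∧
      (w : ZMod f) = (((f / 2 : ℕ) : ZMod f) - 1) * (2 * ((f / 3 : ℕ) : ZMod f) ^ 2 - 1)) :=
  coe_eq_of_forall_odd_isPrimitive_aux f (NeZero.ne f) hval h15 h20 w hw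

end Main


end FermatCharacter

end Literature.AlgebraicGeometry.HodgeTheory
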